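import Literature.MathematicalPhysics.QuantumFieldTheory.Balaban1983to89.T4CouplingChain

/-!
# T⁴ pure Yang–Mills, NE1′ (O3b/H2) — `T4CouplingDomination`: the per-step kernel form MI-F1-K of the dressed
# stability estimate, discharged to (O) a.e. oscillation of consecutive conditional means — or (v3) to (O″) PATHWISE
# pinning of the observable by the revealed history off bad events of summable probability — (J) product domination
# of revealed large-field creation events — itself reduced to TERM-WISE RATIO BOUNDS — and (L) locality first moments

HONEST FRAMING.  This file is MEASURE THEORY and finite combinatorics (kernel-checked folklore; every declaration is
tagged [folklore]).  It concerns the finite-volume T⁴ renormalisation-group tower of [Balaban1983to89] only through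
the DICTIONARY below; it asserts NO printed statement, proves NO estimate of the programme, and is NOT progress on
the Clay Millennium problem (finite T⁴ only; no infinite volume, no mass gap, no reconstruction).  Its consumer —
node NE1′ of the cell's T⁴ ladder, rung (B)+1 — stays CONDITIONAL on the printed inputs named `BetaPertH`, `(B)`,
`(B^μ)` in the cell records, none of which is touched here.  The value of the file is a TYPED REDUCTION: after it,
the lineage's missing inequality MI-F1-K is three explicitly typed hypotheses (O), (J), (L) (plus a counting profile
(N)) on the undressed path law, and (J) is further reduced to a positivity-plus-local-ratio statement of the shape
the large-field currency is printed in.  Nothing printed is claimed to satisfy them.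

CITATION HEADER.  Nothing is cited from the manuscripts under audit; no Literature fact (`def … : Prop`) is
introduced or consumed.  The only import is the cell's own kernel-checked module `T4CouplingChain` (hence
`T4PathwiseCoupling`, `T4MeanChannel`, `T4TubeBudget` and Mathlib's Ionescu–Tulcea / disintegration API).

## Position in the lineage (record `t4/T4-EST-NE1p-P2.md`, §5 MI-F1-K)

`T4PathwiseCoupling` reduced the fluctuation half of NE1′ to a sharpened Azuma inequality over an abstract antitone
filtration, with — under irregular nesting — the binders `hVdom` (predictable variance proxies dominated by
`C²(θ²)^{lvl}·κ^{N} + U`) and `hdom` (product domination of the bad events) of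
`integral_mul_exp_le_uniform_of_nesting_add`.  `T4CouplingChain` realised the frame on ONE path space
`Π b, X b` (backward presentation: `X 0` = unit-lattice endpoint, `X b` = the data revealed at the `b`-th refinement
slot below it, `κ b` = one-step fibre kernel; for standard Borel carriers every finite path law `μ` is the realised
chain of its own posterior kernels `posteriorKernel μ`), identified the conditional variances with the explicit
`oneStepVar κ b φ (x≤b)`, and typed MI-F1-K: «a `μ`-uniform (in the depth) control of `Σ_b oneStepVar
(posteriorKernel μ) b φ (x≤b)` under the UNDRESSED path law `μ` of the printed chain presented backward».
This module supplies the per-step form of the two inputs and the end-to-end statement consuming them: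

* §1 PRODUCT DOMINATION FROM RATIO BOUNDS (abstract finite measure space; discharges `hdom`).
  `measureReal_biInter_le_prod_of_cond`: the chain rule — conditional domination `μ(A j ∩ ⋂_S A i) ≤ ε j·μ(⋂_S A i)`
  for `j ∉ S` ⇒ `μ(⋂_S A j) ≤ μ(Ω)·∏_S ε j`.  `measureReal_biInter_mem_le_prod_of_eraseRatio`: the POLYMER / PEIERLS
  MECHANISM — for a label map `hist : Ω → Finset R` (cell reading: the set of large-field regions CREATED along the
  path, as (level, place) labels read off the printed label functions) with values in a finite universe `U`, the
  TERM-WISE RATIO BOUND `μ{hist = Y} ≤ ε r·μ{hist = Y.erase r}` (`r ∈ Y ⊆ U`) implies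
  `μ(⋂_{r∈S} {r ∈ hist}) ≤ μ(Ω)·∏_{r∈S} ε r` for all `S ⊆ U` (atom decomposition `measureReal_setOf_hist_eq_sum`,
  re-indexing `Y ↦ Y.erase r`, chain rule); `prodDomination_of_eraseRatio`: the same for any injectively labelled
  sub-family — slot by slot, the binder `hdom` of §3.  WHY THIS FORM: the printed large-field currency is (i) the
  positivity of every term of the expansion over large-field histories and (ii) a bound of each term carrying a
  created region `r` by `ε r` times the term with `r` erased (upper bound on the R-renormalised large-field integral
  of the component against a LOWER bound on the small-field integral over the same variables with the same boundary
  data) — a GLOBAL, term-to-term statement; no Bayes denominator, no conditioning on the coarse history and no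
  independence across levels is needed.  Inputs (i), (ii), the closure of admissible histories under erasing a
  created region, and the level-summability of `ε` are NOT proved and NOT cited here: they are the typed content of
  (J) (record §5).  (v2) §1b THE RANKED / SEQUENTIAL FORM (`measureReal_biInter_le_prod_of_cond_ranked`,
  `measureReal_inter_biInter_mem_le_of_eraseRatio_at`, `measureReal_biInter_mem_le_prod_of_eraseRatio_ranked`,
  `prodDomination_of_eraseRatio_ranked`): labels carry a creation RANK `rk : R → ρ` into any linear order (cell
  reading: the step of the printed procedure at which the region is created; the lemma is agnostic), and the ratio
  bound is required ONLY for erasing a label of MAXIMAL rank from a RANK-TRUNCATED history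
  `(hist ω).filter (rk · ≤ m)` — i.e. for undoing the LAST creation of a partial history, which is admissible for
  every sequentially generated family of histories — and still yields `hdom` for ALL sub-families (ordered chain
  rule by `Finset.induction_on_max_value`: condition on the labels of rank ≤ that of the erased one).  The closure
  input thereby disappears; what the ranked form asks instead is the ratio bound for the law of the PARTIAL history
  (in the printed currency: the weight of a partial large-field history summed over all its continuations), again
  NOT proved and NOT cited here.
* §2 ONE-STEP VARIANCES FROM A.E. OSCILLATION ABOUT PREDICTABLE CENTRES (`ae_oneStepVar_frame_le_sq`,
  `ae_oneStepVar_le_sq_of_osc`): if for `μ`-a.e. path `|fiberMean κ (b+1) φ (x≤(b+1)) − ctr (x≤b)| ≤ c (x≤b)` with the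
  centre `ctr` and the radius `c` measurable bounded functions of the length-`b` history, then
  `oneStepVar κ b φ (x≤b) ≤ c (x≤b)²` a.e. (conditional variance ≤ conditional second moment about a predictable
  centre).  Compared with `T4CouplingChain.oneStepVar_le_sq_of_osc` (a SUP over all extensions `u` of `h`), the
  hypothesis is A.E. under the undressed law and the centre is FREE — the form in which analyticity-domain
  (Cauchy-estimate) oscillation radii about the minimiser / background configuration are stated.
* (v3) §2b ONE-STEP VARIANCES FROM PATHWISE OSCILLATION OF THE OBSERVABLE ITSELF, OFF A BAD EVENT
  (`sq_condExp_le_condExp_sq`, `ae_oneStepVar_frame_le_condExp_sq_sub`, `ae_oneStepVar_le_condExp_sq_sub`,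
  `ae_oneStepVar_le_of_pathwise_osc`): `oneStepVar κ b φ (x≤b) ≤ μ[(φ − ctr (x≤b))² ∣ piLE b]` a.e. (the variance of
  the finer conditional mean is at most the conditional second moment of the OBSERVABLE about any predictable centre:
  conditional Jensen at the finer level and the tower property), hence if `|φ x − ctr (x≤b)| ≤ c (x≤b)` for a.e. path
  OUTSIDE a measurable bad event `Bad`, then `oneStepVar κ b φ (x≤b) ≤ min(c (x≤b), 2R)² + (2R)²·fiberMean κ b 1_Bad
  (x≤b)` a.e. — the transport from the observable to its consecutive conditional means («integrating NE1a against
  the one-step posterior», record §5) is thereby the kernel's, and the bad event enters only through its CONDITIONAL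
  PROBABILITY GIVEN THE HISTORY, whose first moment is `μ(Bad)`.
* §3 THE END-TO-END BOUNDS ON THE REALISED CHAIN, UNIFORM IN THE DEPTH (`integral_mul_exp_le_uniform_of_nesting_chain`,
  proxy form; `integral_mul_exp_le_uniform_of_oscillation`, oscillation form; (v3) §3b
  `integral_mul_exp_le_uniform_of_pathwiseOsc`, pathwise-oscillation form) and §4 the same under a GIVEN finite path
  law `μ` on standard Borel carriers with `κ := posteriorKernel μ` (`…_pathLaw`).  Slots `b < n` carry levels
  `lvl b < K` with per-level slot counts `#{b : lvl b = m} ≤ N₀·Λ^m` (whole-level slots: `lvl b = b`, `N₀ = Λ = 1`;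
  block-by-block slots: the block-count profile) and the summability condition is the explicit binder `Λ·θ² < 1`.

## What MI-F1-K is after this module — the exact remaining hypotheses (nothing below is proved or cited)

For the undressed path law `μ` of the printed chain presented backward (finite products of a compact metrisable
group and finite label sets are standard Borel and non-empty, so §4 applies with NO realisation hypothesis), a
bounded unit-lattice observable `φ` and the multiplier `g₀`, `integral_mul_exp_le_uniform_of_oscillation_pathLaw`
gives the endpoint-conditioned exponential-moment bound of NE1′'s fluctuation half with constants free of the depth,
from exactly:
(O) binder `hosc` — for every slot `b` and `μ`-a.e. path,
    `|fiberMean (posteriorKernel μ) (b+1) φ (x≤(b+1)) − ctr b (x≤b)| ≤ C·θ^{lvl b}·κ₁^{#{j ∈ J b : x≤b ∈ G b j}} + ℓ b (x≤b)`: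
    revealing one more slot moves the conditional mean of the unit-scale observable by at most a radius GEOMETRIC IN
    THE LEVEL (the dictionary image of the printed analyticity / regularity radii of the effective densities in the
    fine-level background), inflated by a factor `κ₁` per large-field creation event already revealed within reach
    (`G b j`, measurable sets of histories), plus a locality error `ℓ b`; centres `|ctr b| ≤ R`, radii `0 ≤ ℓ b ≤ ℓmax`
    measurable in the history (all w.l.o.g. normalisations);
(J) binder `hdom` — product domination of the within-reach creation events under `μ` with level budget
    `Σ_{j∈J b} ε b j ≤ E`, obtained by §1 from the term-wise ratio bound (i)+(ii) above, or by §1b from its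
    last-created (rank-truncated) form;
(L) binder `hL` — `Σ_{b<n} ∫ ℓ b (x≤b)² dμ ≤ Ltot` (locality first moments; ownership: carver Q26(1));
(N) the counting profile `hlvl`/`hcard` and `Λ·θ² < 1` (deterministic lattice geometry versus the radius decay rate —
    the quantitative heart of MI-F1, displayed as a hypothesis, not asserted).
(v3) ALTERNATIVELY, `integral_mul_exp_le_uniform_of_pathwiseOsc_pathLaw` replaces (O) by the pair
(O″) binder `hoscP` — for every slot `b` and `μ`-a.e. path NOT in `Bad b`,
    `|φ x − ctr b (x≤b)| ≤ C·θ^{lvl b}·κ₁^{#{j ∈ J b : x≤b ∈ G b j}} + ℓ b (x≤b)`: the OBSERVABLE ITSELF is pinned by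
    the history revealed down to slot `b` to within the same radius (the dictionary image of: on the small-field
    region the fine field is the background determined by the block averages plus a fluctuation whose effect on a
    unit-scale observable decays geometrically in the level), except on a measurable bad event `Bad b` of paths
    (dictionary image: a fine large field within reach of the loop, not yet revealed at slot `b`);
(P) binder `hP` — `Σ_{b<n} μ(Bad b) ≤ Ptot`: a plain FIRST-MOMENT budget of the bad events (no product structure);
at the price of the additive term `(2R)²·Ptot` in the bracket; (J), (L), (N) unchanged.  Neither (O″) nor (P) is
proved or cited here.
The mean channel (MI-3: `towerMean` versus the undressed mean) is the β-function node's and is untouched.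

## What this file does NOT do

It does not define the printed densities, label functions or kernels; it does not prove or cite (O), (O″), (P), (J),
(L), (N) for them; it does not treat the mean channel, infinite volume, or any continuum / mass-gap statement.
-/

noncomputable section

open MeasureTheory ProbabilityTheory Finset Preorder Function
open scoped ProbabilityTheory ENNReal

namespace Literature.MathematicalPhysics.QuantumFieldTheory.Balaban1983to89.T4CouplingDomination

open MeasureTheory.Filtration
open Literature.MathematicalPhysics.QuantumFieldTheory.Balaban1983to89.T4MeanChannel
open Literature.MathematicalPhysics.QuantumFieldTheory.Balaban1983to89.T4PathwiseCoupling
open Literature.MathematicalPhysics.QuantumFieldTheory.Balaban1983to89.T4CouplingChain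
open Literature.MathematicalPhysics.QuantumFieldTheory.Balaban1983to89.T4TubeBudget (geomPolyConst geomPolyConst_nonneg)

/-! ## §1  Product domination of event families (binder `hdom`) from chain-rule / term-wise ratio bounds -/

section Domination

variable {Ω : Type*} {mΩ : MeasurableSpace Ω} {μ : Measure Ω} [IsFiniteMeasure μ] {ι : Type*}

omit [IsFiniteMeasure μ] in
/-- [folklore] **PRODUCT DOMINATION FROM CONDITIONAL DOMINATION (chain rule).**  If for every `j ∈ J` and every
`S ⊆ J` not containing `j`, `μ(A j ∩ ⋂_{i∈S} A i) ≤ ε j · μ(⋂_{i∈S} A i)` (the probability of the event `A j` GIVEN any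
conjunction of the other events of the family is at most `ε j`), then `μ(⋂_{j∈S} A j) ≤ μ(Ω)·∏_{j∈S} ε j` for every
`S ⊆ J` — the binder `hdom` of `T4PathwiseCoupling.integral_pow_card_filter_le_exp` /
`integral_mul_exp_le_uniform_of_nesting(_add)`. -/
theorem measureReal_biInter_le_prod_of_cond (J : Finset ι) {A : ι → Set Ω} {ε : ι → ℝ}
    (hε : ∀ j ∈ J, 0 ≤ ε j)
    (hcond : ∀ j ∈ J, ∀ S ⊆ J, j ∉ S →
      μ.real (A j ∩ ⋂ i ∈ S, A i) ≤ ε j * μ.real (⋂ i ∈ S, A i)) :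
    ∀ S ⊆ J, μ.real (⋂ j ∈ S, A j) ≤ μ.real Set.univ * ∏ j ∈ S, ε j := by
  classical
  intro S hS
  induction S using Finset.induction_on with
  | empty => simp
  | @insert j S hj ih =>
    have hjJ : j ∈ J := hS (mem_insert_self j S)
    have hSJ : S ⊆ J := fun i hi => hS (mem_insert_of_mem hi)
    rw [set_biInter_insert, prod_insert hj]
    calc μ.real (A j ∩ ⋂ i ∈ S, A i) ≤ ε j * μ.real (⋂ i ∈ S, A i) := hcond j hjJ S hSJ hj
      _ ≤ ε j * (μ.real Set.univ * ∏ i ∈ S, ε i) := mul_le_mul_of_nonneg_left (ih hSJ) (hε j hjJ)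
      _ = μ.real Set.univ * (ε j * ∏ i ∈ S, ε i) := by ring

omit [IsFiniteMeasure μ] in
/-- [folklore] **RANKED (ORDERED) CHAIN RULE.**  Give the indices a rank `rk : ι → ρ` in a linear order (cell
reading: the step of the procedure at which the event's region is created).  It suffices to dominate `A j`
conditionally on conjunctions of events of rank AT MOST that of `j`: if `μ(A j ∩ ⋂_{i∈S} A i) ≤ ε j · μ(⋂_{i∈S} A i)`
whenever `j ∉ S` and `rk i ≤ rk j` for all `i ∈ S`, then `μ(⋂_{j∈S} A j) ≤ μ(Ω)·∏_{j∈S} ε j` for every `S ⊆ J`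
(peel off an index of maximal rank, `Finset.induction_on_max_value`). -/
theorem measureReal_biInter_le_prod_of_cond_ranked {ρ : Type*} [LinearOrder ρ] (rk : ι → ρ) (J : Finset ι)
    {A : ι → Set Ω} {ε : ι → ℝ} (hε : ∀ j ∈ J, 0 ≤ ε j)
    (hcond : ∀ j ∈ J, ∀ S ⊆ J, j ∉ S → (∀ i ∈ S, rk i ≤ rk j) →
      μ.real (A j ∩ ⋂ i ∈ S, A i) ≤ ε j * μ.real (⋂ i ∈ S, A i)) :
    ∀ S ⊆ J, μ.real (⋂ j ∈ S, A j) ≤ μ.real Set.univ * ∏ j ∈ S, ε j := by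
  classical
  intro S
  refine Finset.induction_on_max_value
    (motive := fun S => S ⊆ J → μ.real (⋂ j ∈ S, A j) ≤ μ.real Set.univ * ∏ j ∈ S, ε j) rk S ?_ ?_
  · intro _; simp
  · intro j S hj hmax ih hS
    have hjJ : j ∈ J := hS (mem_insert_self j S)
    have hSJ : S ⊆ J := fun i hi => hS (mem_insert_of_mem hi)
    rw [set_biInter_insert, prod_insert hj]
    calc μ.real (A j ∩ ⋂ i ∈ S, A i) ≤ ε j * μ.real (⋂ i ∈ S, A i) := hcond j hjJ S hSJ hj hmax
      _ ≤ ε j * (μ.real Set.univ * ∏ i ∈ S, ε i) := mul_le_mul_of_nonneg_left (ih hSJ) (hε j hjJ)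
      _ = μ.real Set.univ * (ε j * ∏ i ∈ S, ε i) := by ring

variable {R : Type*} [DecidableEq R]

/-- [folklore] The atoms `{hist = Y}` of a finitely-valued label map are measurable when the membership events are. -/
theorem measurableSet_hist_eq (U : Finset R) {hist : Ω → Finset R} (hU : ∀ ω, hist ω ⊆ U)
    (hmeas : ∀ r ∈ U, MeasurableSet {ω | r ∈ hist ω}) (Y : Finset R) (hY : Y ⊆ U) :
    MeasurableSet {ω | hist ω = Y} := by
  have hset : {ω | hist ω = Y} =
      ⋂ r ∈ U, (if r ∈ Y then {ω | r ∈ hist ω} else {ω | r ∈ hist ω}ᶜ) := by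
    ext ω
    simp only [Set.mem_setOf_eq, Set.mem_iInter]
    constructor
    · rintro rfl r _
      by_cases hr : r ∈ hist ω
      · simp [hr]
      · simp [hr]
    · intro h
      ext r
      by_cases hrU : r ∈ U
      · have hr := h r hrU
        by_cases hrY : r ∈ Y
        · simp only [hrY, if_true, Set.mem_setOf_eq] at hr
          exact ⟨fun _ => hrY, fun _ => hr⟩
        · simp only [hrY, if_false, Set.mem_compl_iff, Set.mem_setOf_eq] at hr
          exact ⟨fun h' => (hr h').elim, fun h' => (hrY h').elim⟩
      · exact ⟨fun h' => (hrU (hU ω h')).elim, fun h' => (hrU (hY h')).elim⟩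
  rw [hset]
  refine U.measurableSet_biInter fun r hr => ?_
  by_cases hrY : r ∈ Y
  · simpa [hrY] using hmeas r hr
  · simpa [hrY] using (hmeas r hr).compl

/-- [folklore] **Atom decomposition**: an event determined by the label map is the disjoint union of the atoms
`{hist = Y}` over the admissible label sets `Y ⊆ U` it contains, so its mass is the corresponding sum. -/
theorem measureReal_setOf_hist_eq_sum (U : Finset R) {hist : Ω → Finset R} (hU : ∀ ω, hist ω ⊆ U)
    (hmeas : ∀ r ∈ U, MeasurableSet {ω | r ∈ hist ω}) (P : Finset R → Prop) [DecidablePred P] :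
    μ.real {ω | P (hist ω)} = ∑ Y ∈ U.powerset.filter P, μ.real {ω | hist ω = Y} := by
  have hset : {ω | P (hist ω)} = ⋃ Y ∈ U.powerset.filter P, {ω | hist ω = Y} := by
    ext ω
    simp only [Set.mem_setOf_eq, Set.mem_iUnion, mem_filter, mem_powerset, exists_prop]
    constructor
    · intro h
      exact ⟨hist ω, ⟨hU ω, h⟩, rfl⟩
    · rintro ⟨Y, ⟨_, hP⟩, rfl⟩
      exact hP
  rw [hset, measureReal_biUnion_finset]
  · intro Y _ Y' _ hYY'
    exact Set.disjoint_left.2 fun ω (h : hist ω = Y) (h' : hist ω = Y') => hYY' (h.symm.trans h')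
  · intro Y hY
    exact measurableSet_hist_eq U hU hmeas Y (mem_powerset.1 (mem_filter.1 hY).1)

/-- [folklore] **ONE CONDITIONAL STEP FROM TERM-WISE RATIO BOUNDS AT A FIXED LABEL.**  For a label map
`hist : Ω → Finset R` with values in `U` and measurable membership events, a label `j ∈ U` and a finite `S ∌ j`:
if `μ{hist = Y} ≤ e · μ{hist = Y.erase j}` for every `Y ⊆ U` containing `j` and `S`, then
`μ({j ∈ hist} ∩ ⋂_{i∈S} {i ∈ hist}) ≤ e · μ(⋂_{i∈S} {i ∈ hist})` (sum the ratio bound over the atoms containing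
`S ∪ {j}` — `measureReal_setOf_hist_eq_sum` — and re-index by `Y ↦ Y.erase j`). -/
theorem measureReal_inter_biInter_mem_le_of_eraseRatio_at (U : Finset R) {hist : Ω → Finset R}
    (hU : ∀ ω, hist ω ⊆ U) (hmeas : ∀ r ∈ U, MeasurableSet {ω | r ∈ hist ω}) {j : R} (hjU : j ∈ U)
    {S : Finset R} (hjS : j ∉ S) {e : ℝ} (he : 0 ≤ e)
    (hratio : ∀ Y ⊆ U, j ∈ Y → S ⊆ Y → μ.real {ω | hist ω = Y} ≤ e * μ.real {ω | hist ω = Y.erase j}) :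
    μ.real ({ω | j ∈ hist ω} ∩ ⋂ i ∈ S, {ω | i ∈ hist ω}) ≤ e * μ.real (⋂ i ∈ S, {ω | i ∈ hist ω}) := by
  -- the three events as label predicates
  have hL : (({ω | j ∈ hist ω} : Set Ω) ∩ ⋂ i ∈ S, {ω | i ∈ hist ω}) = {ω | j ∈ hist ω ∧ S ⊆ hist ω} := by
    ext ω; simp [Finset.subset_iff]
  have hRset : (⋂ i ∈ S, ({ω | i ∈ hist ω} : Set Ω)) = {ω | S ⊆ hist ω} := by
    ext ω; simp [Finset.subset_iff]
  have hsub : ({ω | j ∉ hist ω ∧ S ⊆ hist ω} : Set Ω) ⊆ {ω | S ⊆ hist ω} := fun ω h => h.2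
  rw [hL, hRset, measureReal_setOf_hist_eq_sum U hU hmeas (fun Y => j ∈ Y ∧ S ⊆ Y)]
  -- bound each atom by the ratio bound and re-index by erasing `j`
  calc ∑ Y ∈ U.powerset.filter (fun Y => j ∈ Y ∧ S ⊆ Y), μ.real {ω | hist ω = Y}
      ≤ ∑ Y ∈ U.powerset.filter (fun Y => j ∈ Y ∧ S ⊆ Y), e * μ.real {ω | hist ω = Y.erase j} :=
        sum_le_sum fun Y hY =>
          hratio Y (mem_powerset.1 (mem_filter.1 hY).1) (mem_filter.1 hY).2.1 (mem_filter.1 hY).2.2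
    _ = e * ∑ Y ∈ U.powerset.filter (fun Y => j ∈ Y ∧ S ⊆ Y), μ.real {ω | hist ω = Y.erase j} := by
        rw [mul_sum]
    _ = e * ∑ Y ∈ U.powerset.filter (fun Y => j ∉ Y ∧ S ⊆ Y), μ.real {ω | hist ω = Y} := by
        congr 1
        refine sum_nbij' (fun Y => Y.erase j) (fun Y => insert j Y) ?_ ?_ ?_ ?_ ?_
        · intro Y hY
          obtain ⟨hYU, hjY, hSY⟩ := by simpa only [mem_filter, mem_powerset] using hY
          simp only [mem_filter, mem_powerset]
          refine ⟨(erase_subset j Y).trans hYU, notMem_erase j Y, fun i hi => ?_⟩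
          exact mem_erase.2 ⟨fun h => hjS (h ▸ hi), hSY hi⟩
        · intro Y hY
          obtain ⟨hYU, _, hSY⟩ := by simpa only [mem_filter, mem_powerset] using hY
          simp only [mem_filter, mem_powerset]
          exact ⟨insert_subset hjU hYU, mem_insert_self j Y, fun i hi => mem_insert_of_mem (hSY hi)⟩
        · intro Y hY
          obtain ⟨_, hjY, _⟩ := by simpa only [mem_filter, mem_powerset] using hY
          exact insert_erase hjY
        · intro Y hY
          obtain ⟨_, hjY, _⟩ := by simpa only [mem_filter, mem_powerset] using hY
          exact erase_insert hjY
        · intro Y _; rfl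
    _ = e * μ.real {ω | j ∉ hist ω ∧ S ⊆ hist ω} := by
        rw [measureReal_setOf_hist_eq_sum U hU hmeas (fun Y => j ∉ Y ∧ S ⊆ Y)]
    _ ≤ e * μ.real {ω | S ⊆ hist ω} := mul_le_mul_of_nonneg_left (measureReal_mono hsub) he

/-- [folklore] **PRODUCT DOMINATION FROM TERM-WISE RATIO BOUNDS (positivity + local ratio; the polymer / Peierls
mechanism).**  Let `hist : Ω → Finset R` be a label map with values in a finite universe `U` (cell reading: the set
of large-field regions CREATED along the path — (level, place) pairs — read off the labels), with measurable
membership events `{r ∈ hist}`.  Suppose the TERM-WISE RATIO BOUND: for every admissible label set `Y ⊆ U` and every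
`r ∈ Y`, `μ{hist = Y} ≤ ε r · μ{hist = Y.erase r}` — the total weight of the term carrying the region `r` is at most
`ε r` times the weight of the SAME term with `r` erased (which is how an upper bound on the renormalised large-field
integral of a component against a LOWER bound on the small-field integral of the same variables reads, once every
term is non-negative; nothing printed is asserted).  Then the creation events are dominated by products:
`μ(⋂_{r∈S} {r ∈ hist}) ≤ μ(Ω)·∏_{r∈S} ε r` for every `S ⊆ U` (via the chain-rule form: sum the ratio bound over the
atoms containing `S ∪ {r}` and re-index by `Y ↦ Y.erase r`). -/
theorem measureReal_biInter_mem_le_prod_of_eraseRatio (U : Finset R) {hist : Ω → Finset R}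
    (hU : ∀ ω, hist ω ⊆ U) (hmeas : ∀ r ∈ U, MeasurableSet {ω | r ∈ hist ω}) {ε : R → ℝ}
    (hε : ∀ r ∈ U, 0 ≤ ε r)
    (hratio : ∀ Y ⊆ U, ∀ r ∈ Y, μ.real {ω | hist ω = Y} ≤ ε r * μ.real {ω | hist ω = Y.erase r}) :
    ∀ S ⊆ U, μ.real (⋂ r ∈ S, {ω | r ∈ hist ω}) ≤ μ.real Set.univ * ∏ r ∈ S, ε r :=
  measureReal_biInter_le_prod_of_cond U hε fun j hjU _ _ hjS =>
    measureReal_inter_biInter_mem_le_of_eraseRatio_at U hU hmeas hjU hjS (hε j hjU)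
      fun Y hYU hjY _ => hratio Y hYU j hjY

/-- [folklore] **PRODUCT DOMINATION FROM LAST-CREATED RATIO BOUNDS (ranked / sequential form of the
previous theorem).**  Rank the labels by `rk : R → ρ` (cell reading: the step of the printed procedure at which the
large-field region is created) and let `hist↾m ω := (hist ω).filter (rk · ≤ m)` be the RANK-TRUNCATED history (the partial
history up to step `m`).  Suppose the ratio bound ONLY for erasing a label of MAXIMAL rank from a truncated history:
for every `m`, every `Y ⊆ U` all of whose labels have rank `≤ m` and every `r ∈ Y` with `rk r = m`,
`μ{hist↾m = Y} ≤ ε r · μ{hist↾m = Y.erase r}` — undoing the LAST creation of a partial history, which keeps every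
sequentially generated history admissible, at the price that the bound concerns the law of the PARTIAL history
(the weight of `Y` summed over all its continuations).  Then still `μ(⋂_{r∈S} {r ∈ hist}) ≤ μ(Ω)·∏_{r∈S} ε r` for
EVERY `S ⊆ U` (ranked chain rule + the one-step lemma applied to `hist↾(rk j)`; atoms `{hist↾m = Y}` with a label of
rank `> m` in `Y` are empty).  Nothing printed is asserted. -/
theorem measureReal_biInter_mem_le_prod_of_eraseRatio_ranked (U : Finset R) {ρ : Type*} [LinearOrder ρ]
    (rk : R → ρ) {hist : Ω → Finset R}
    (hU : ∀ ω, hist ω ⊆ U) (hmeas : ∀ r ∈ U, MeasurableSet {ω | r ∈ hist ω}) {ε : R → ℝ}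
    (hε : ∀ r ∈ U, 0 ≤ ε r)
    (hratio : ∀ m : ρ, ∀ Y ⊆ U, (∀ r ∈ Y, rk r ≤ m) → ∀ r ∈ Y, rk r = m →
      μ.real {ω | (hist ω).filter (fun i => rk i ≤ m) = Y}
        ≤ ε r * μ.real {ω | (hist ω).filter (fun i => rk i ≤ m) = Y.erase r}) :
    ∀ S ⊆ U, μ.real (⋂ r ∈ S, {ω | r ∈ hist ω}) ≤ μ.real Set.univ * ∏ r ∈ S, ε r := by
  classical
  refine measureReal_biInter_le_prod_of_cond_ranked rk U hε fun j hjU S _ hjS hmax => ?_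
  -- pass to the history truncated at the rank of `j`
  have hEq : ∀ i, rk i ≤ rk j →
      ({ω | i ∈ (hist ω).filter fun i' => rk i' ≤ rk j} : Set Ω) = {ω | i ∈ hist ω} := by
    intro i hi; ext ω; simp [mem_filter, hi]
  have hEqS : (⋂ i ∈ S, ({ω | i ∈ (hist ω).filter fun i' => rk i' ≤ rk j} : Set Ω)) =
      ⋂ i ∈ S, {ω | i ∈ hist ω} :=
    Set.iInter_congr fun i => Set.iInter_congr fun hi => hEq i (hmax i hi)
  have hTU : ∀ ω, ((hist ω).filter fun i' => rk i' ≤ rk j) ⊆ U :=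
    fun ω => (filter_subset _ _).trans (hU ω)
  have hmeasT : ∀ r ∈ U, MeasurableSet {ω | r ∈ (hist ω).filter fun i' => rk i' ≤ rk j} := by
    intro r hr
    by_cases h : rk r ≤ rk j
    · rw [hEq r h]; exact hmeas r hr
    · have h0 : ({ω | r ∈ (hist ω).filter fun i' => rk i' ≤ rk j} : Set Ω) = ∅ := by
        ext ω; simp [mem_filter, h]
      rw [h0]; exact MeasurableSet.empty
  rw [← hEq j le_rfl, ← hEqS]
  refine measureReal_inter_biInter_mem_le_of_eraseRatio_at U hTU hmeasT hjU hjS (hε j hjU)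
    fun Y hYU hjY _ => ?_
  by_cases hYm : ∀ r ∈ Y, rk r ≤ rk j
  · exact hratio (rk j) Y hYU hYm j hjY rfl
  · -- an atom prescribing a label of rank `> rk j` to the truncated history is empty
    have h0 : ({ω | ((hist ω).filter fun i' => rk i' ≤ rk j) = Y} : Set Ω) = ∅ := by
      ext ω
      simp only [Set.mem_setOf_eq, Set.mem_empty_iff_false, iff_false]
      intro h
      exact hYm fun r hr => (mem_filter.1 (h ▸ hr : r ∈ (hist ω).filter fun i' => rk i' ≤ rk j)).2
    rw [h0, measureReal_empty]
    exact mul_nonneg (hε j hjU) measureReal_nonneg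

omit [IsFiniteMeasure μ] in
/-- [folklore] Transport of a product-domination bound for membership events `{r ∈ hist}` (`S ⊆ U`) to any
INJECTIVELY LABELLED finite family `A j = {r j ∈ hist}` (`r` injective on `J`, valued in `U`): the `hdom` shape of
§3 with rates `ε (r j)` (`Finset.prod_image`). -/
theorem prodDomination_of_labelled (U : Finset R) {hist : Ω → Finset R} {ε : R → ℝ}
    (hprod : ∀ S ⊆ U, μ.real (⋂ r ∈ S, {ω | r ∈ hist ω}) ≤ μ.real Set.univ * ∏ r ∈ S, ε r)
    (J : Finset ι) {A : ι → Set Ω} {r : ι → R} (hrU : ∀ j ∈ J, r j ∈ U) (hinj : Set.InjOn r J)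
    (hA : ∀ j ∈ J, A j = {ω | r j ∈ hist ω}) :
    ∀ S ⊆ J, μ.real (⋂ j ∈ S, A j) ≤ μ.real Set.univ * ∏ j ∈ S, ε (r j) := by
  intro S hS
  have hSinj : Set.InjOn r S := hinj.mono (Finset.coe_subset.2 hS)
  have h1 : (⋂ j ∈ S, A j) = ⋂ r' ∈ S.image r, {ω | r' ∈ hist ω} := by
    ext ω
    simp only [Set.mem_iInter, Set.mem_setOf_eq, mem_image]
    constructor
    · rintro h r' ⟨j, hj, rfl⟩
      have hω := h j hj
      rwa [hA j (hS hj)] at hω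
    · intro h j hj
      rw [hA j (hS hj)]
      exact h (r j) ⟨j, hj, rfl⟩
  rw [h1, ← Finset.prod_image hSinj]
  exact hprod (S.image r) fun r' hr' => by
    obtain ⟨j, hj, rfl⟩ := mem_image.1 hr'
    exact hrU j (hS hj)

/-- [folklore] **`hdom` FOR AN INJECTIVELY LABELLED SUB-FAMILY (slot-by-slot form of
`measureReal_biInter_mem_le_prod_of_eraseRatio`).**  If the
events of a finite family are membership events of distinct labels — `A j = {r j ∈ hist}` with `r` injective on `J`
and valued in `U` — then the term-wise ratio bound gives the product domination of the family with rates
`ε (r j)`: literally the binder `hdom` of §3 at one slot (cell reading: `J` = the creation events within reach of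
the slot, `r j` = their (level, place) labels). -/
theorem prodDomination_of_eraseRatio (U : Finset R) {hist : Ω → Finset R}
    (hU : ∀ ω, hist ω ⊆ U) (hmeas : ∀ r ∈ U, MeasurableSet {ω | r ∈ hist ω}) {ε : R → ℝ}
    (hε : ∀ r ∈ U, 0 ≤ ε r)
    (hratio : ∀ Y ⊆ U, ∀ r ∈ Y, μ.real {ω | hist ω = Y} ≤ ε r * μ.real {ω | hist ω = Y.erase r})
    (J : Finset ι) {A : ι → Set Ω} {r : ι → R} (hrU : ∀ j ∈ J, r j ∈ U) (hinj : Set.InjOn r J)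
    (hA : ∀ j ∈ J, A j = {ω | r j ∈ hist ω}) :
    ∀ S ⊆ J, μ.real (⋂ j ∈ S, A j) ≤ μ.real Set.univ * ∏ j ∈ S, ε (r j) :=
  prodDomination_of_labelled U (measureReal_biInter_mem_le_prod_of_eraseRatio U hU hmeas hε hratio) J hrU hinj hA

/-- [folklore] **`hdom` FOR AN INJECTIVELY LABELLED SUB-FAMILY FROM LAST-CREATED RATIO BOUNDS** (ranked form of the
previous theorem: the ratio bound is only asked for erasing a label of maximal rank from a rank-truncated history). -/
theorem prodDomination_of_eraseRatio_ranked (U : Finset R) {ρ : Type*} [LinearOrder ρ] (rk : R → ρ)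
    {hist : Ω → Finset R}
    (hU : ∀ ω, hist ω ⊆ U) (hmeas : ∀ r ∈ U, MeasurableSet {ω | r ∈ hist ω}) {ε : R → ℝ}
    (hε : ∀ r ∈ U, 0 ≤ ε r)
    (hratio : ∀ m : ρ, ∀ Y ⊆ U, (∀ r ∈ Y, rk r ≤ m) → ∀ r ∈ Y, rk r = m →
      μ.real {ω | (hist ω).filter (fun i => rk i ≤ m) = Y}
        ≤ ε r * μ.real {ω | (hist ω).filter (fun i => rk i ≤ m) = Y.erase r})
    (J : Finset ι) {A : ι → Set Ω} {r : ι → R} (hrU : ∀ j ∈ J, r j ∈ U) (hinj : Set.InjOn r J)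
    (hA : ∀ j ∈ J, A j = {ω | r j ∈ hist ω}) :
    ∀ S ⊆ J, μ.real (⋂ j ∈ S, A j) ≤ μ.real Set.univ * ∏ j ∈ S, ε (r j) :=
  prodDomination_of_labelled U (measureReal_biInter_mem_le_prod_of_eraseRatio_ranked U rk hU hmeas hε hratio)
    J hrU hinj hA

end Domination

/-! ## §2  One-step conditional variances from a.e. oscillation of consecutive fibre means about predictable centres -/

section Oscillation

variable {X : ℕ → Type*} [∀ n, MeasurableSpace (X n)]
variable {κ : (b : ℕ) → Kernel (Π i : Iic b, X i) (X (b + 1))} [∀ b, IsMarkovKernel (κ b)]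

/-- [folklore] **ONE-STEP CONDITIONAL VARIANCE ≤ (A.E. OSCILLATION RADIUS ABOUT A PREDICTABLE CENTRE)², frame-indexed.**
On the realised chain `trajMeasure ν κ` with its frame filtration of depth `n`, at frame step `i < n` (chain slot
`b = n-(i+1)`): if the finer fibre mean `fiberMean κ (b+1) φ (x≤(b+1))` stays, for a.e. path, within `c x` of an
`F (i+1)`-measurable (i.e. determined by the coarser history `x≤b`) bounded centre `Z x`, with `c` itself
`F (i+1)`-measurable and bounded, then `oneStepVar κ b φ (x≤b) ≤ (c x)²` for a.e. path.  (Conditional variance ≤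
conditional second moment about any predictable centre, `T4PathwiseCoupling.condExp_incr_sq_le_condExp_sq_sub`, read
through `T4CouplingChain.condExp_incr_sq_frame_ae_eq` / `condExp_piLE_ae_eq`.) -/
theorem ae_oneStepVar_frame_le_sq (ν : Measure (X 0)) [IsFiniteMeasure ν] (n : ℕ) {φ : (Π k, X k) → ℝ}
    (hφm : StronglyMeasurable φ) {R : ℝ} (hφR : ∀ x, |φ x| ≤ R) {i : ℕ} (hi : i < n)
    {Z c : (Π k, X k) → ℝ} (hZm : StronglyMeasurable[frameFiltration X n (i + 1)] Z) {CZ : ℝ}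
    (hZb : ∀ x, |Z x| ≤ CZ) (hcm : StronglyMeasurable[frameFiltration X n (i + 1)] c) {cmax : ℝ}
    (hcb : ∀ x, |c x| ≤ cmax)
    (hosc : ∀ᵐ x ∂(Kernel.trajMeasure ν κ),
      |fiberMean κ (n - (i + 1) + 1) φ (frestrictLe (n - (i + 1) + 1) x) - Z x| ≤ c x) :
    ∀ᵐ x ∂(Kernel.trajMeasure ν κ),
      oneStepVar κ (n - (i + 1)) φ (frestrictLe (n - (i + 1)) x) ≤ c x ^ 2 := by
  have hF := antitone_frameFiltration (X := X) n
  have hFle := frameFiltration_le (X := X) n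
  have hφ : Integrable φ (Kernel.trajMeasure ν κ) := integrable_of_abs_le_const hφm hφR
  have h1 := condExp_incr_sq_frame_ae_eq (κ := κ) ν n hφm hφR hi
  have h2 := condExp_incr_sq_le_condExp_sq_sub (μ := Kernel.trajMeasure ν κ) hF hFle hφR i hZm hZb
  have hM := condExp_piLE_ae_eq (κ := κ) ν (n - (i + 1) + 1) hφ
  -- (M − Z)² ≤ c² a.e.
  have h3 : (fun x => ((Kernel.trajMeasure ν κ)[φ | frameFiltration X n i] x - Z x) ^ 2) ≤ᵐ[Kernel.trajMeasure ν κ]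
      fun x => c x ^ 2 := by
    rw [frameFiltration_eq_succ hi]
    filter_upwards [hM, hosc] with x hx hoscx
    rw [hx, ← sq_abs]
    exact pow_le_pow_left₀ (abs_nonneg _) hoscx 2
  -- integrability of both sides
  have hc2m : StronglyMeasurable[frameFiltration X n (i + 1)] (fun x => c x ^ 2) := hcm.pow 2
  have hc2i : Integrable (fun x => c x ^ 2) (Kernel.trajMeasure ν κ) :=
    integrable_sq_of_ae_abs_le (hcm.mono (hFle (i + 1))).aestronglyMeasurable (ae_of_all _ hcb)
  have hMZi : Integrable (fun x => ((Kernel.trajMeasure ν κ)[φ | frameFiltration X n i] x - Z x) ^ 2)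
      (Kernel.trajMeasure ν κ) := by
    refine integrable_sq_of_ae_abs_le (bu := R + CZ)
      ((stronglyMeasurable_condExp.mono (hFle i)).aestronglyMeasurable.sub
        (hZm.mono (hFle (i + 1))).aestronglyMeasurable) ?_
    filter_upwards [ae_abs_condExp_le (μ := Kernel.trajMeasure ν κ) (m := frameFiltration X n i) hφR]
      with x hx
    exact (abs_sub _ _).trans (add_le_add hx (hZb x))
  have h4 := condExp_mono (m := frameFiltration X n (i + 1)) hMZi hc2i h3
  have h5 : (Kernel.trajMeasure ν κ)[fun x => c x ^ 2 | frameFiltration X n (i + 1)] = fun x => c x ^ 2 :=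
    condExp_of_stronglyMeasurable (hFle (i + 1)) hc2m hc2i
  rw [h5] at h4
  filter_upwards [h1, h2, h4] with x hx1 hx2 hx4
  rw [← hx1]
  exact hx2.trans hx4

/-- [folklore] **ONE-STEP CONDITIONAL VARIANCE ≤ (A.E. OSCILLATION RADIUS)², chain-indexed** — hypothesis (O) of the
record in per-step kernel form.  At chain slot `b`: if for a.e. path `|fiberMean κ (b+1) φ (x≤(b+1)) − ctr (x≤b)| ≤
c (x≤b)` with `ctr`, `c` measurable bounded functions of the length-`b` history (the centre and the radius are
PREDICTABLE: they may depend on everything revealed so far, in particular on which large-field creation events have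
occurred), then `oneStepVar κ b φ (x≤b) ≤ c (x≤b)²` for a.e. path. -/
theorem ae_oneStepVar_le_sq_of_osc (ν : Measure (X 0)) [IsFiniteMeasure ν] (b : ℕ) {φ : (Π k, X k) → ℝ}
    (hφm : StronglyMeasurable φ) {R : ℝ} (hφR : ∀ x, |φ x| ≤ R)
    {ctr c : (Π i : Iic b, X i) → ℝ} (hctrm : StronglyMeasurable ctr) {CZ : ℝ} (hctrb : ∀ h, |ctr h| ≤ CZ)
    (hcm : StronglyMeasurable c) {cmax : ℝ} (hcb : ∀ h, |c h| ≤ cmax)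
    (hosc : ∀ᵐ x ∂(Kernel.trajMeasure ν κ),
      |fiberMean κ (b + 1) φ (frestrictLe (b + 1) x) - ctr (frestrictLe b x)| ≤ c (frestrictLe b x)) :
    ∀ᵐ x ∂(Kernel.trajMeasure ν κ), oneStepVar κ b φ (frestrictLe b x) ≤ c (frestrictLe b x) ^ 2 := by
  have e1 : frameFiltration X (b + 1) (0 + 1) = piLE (X := X) b := by
    simp only [frameFiltration, Nat.zero_add, Nat.add_sub_cancel]
  have hZm : StronglyMeasurable[frameFiltration X (b + 1) (0 + 1)] (fun x : Π k, X k => ctr (frestrictLe b x)) := by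
    rw [e1]; exact stronglyMeasurable_comp_frestrictLe hctrm
  have hcm' : StronglyMeasurable[frameFiltration X (b + 1) (0 + 1)] (fun x : Π k, X k => c (frestrictLe b x)) := by
    rw [e1]; exact stronglyMeasurable_comp_frestrictLe hcm
  have h := ae_oneStepVar_frame_le_sq (κ := κ) ν (b + 1) hφm hφR (i := 0) (Nat.succ_pos b) hZm
    (fun x => hctrb _) hcm' (fun x => hcb _) hosc
  exact h

end Oscillation

/-! ## §2b  One-step conditional variances from PATHWISE oscillation of the observable itself about predictable
centres, off a bad event -/

section CondJensen

variable {Ω : Type*} {m mΩ : MeasurableSpace Ω} {μ : Measure Ω} [IsFiniteMeasure μ]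

/-- [folklore] **Conditional Jensen for the square**: `(μ[g|m])² ≤ μ[g²|m]` a.e., for `g ∈ L²` (Mathlib's conditional
variance identity `condVar_ae_eq_condExp_sq_sub_sq_condExp` and `0 ≤ Var[g | m]`). -/
theorem sq_condExp_le_condExp_sq (hm : m ≤ mΩ) {g : Ω → ℝ} (hg : MemLp g 2 μ) :
    ∀ᵐ ω ∂μ, (μ[g|m]) ω ^ 2 ≤ (μ[fun ω => g ω ^ 2|m]) ω := by
  have h0 : 0 ≤ᵐ[μ] ProbabilityTheory.condVar m g μ :=
    condExp_nonneg (ae_of_all μ fun ω => by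
      simp only [Pi.zero_apply, Pi.pow_apply, Pi.sub_apply]
      exact sq_nonneg _)
  have h1 := condVar_ae_eq_condExp_sq_sub_sq_condExp hm hg
  have hpi : (g ^ 2 : Ω → ℝ) = fun ω => g ω ^ 2 := rfl
  rw [hpi] at h1
  filter_upwards [h0, h1] with ω h0 h1
  rw [h1] at h0
  simp only [Pi.zero_apply, Pi.sub_apply, Pi.pow_apply] at h0
  linarith

end CondJensen

section Pathwise

variable {X : ℕ → Type*} [∀ n, MeasurableSpace (X n)]
variable {κ : (b : ℕ) → Kernel (Π i : Iic b, X i) (X (b + 1))} [∀ b, IsMarkovKernel (κ b)]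

/-- [folklore] **ONE-STEP CONDITIONAL VARIANCE ≤ CONDITIONAL SECOND MOMENT OF THE OBSERVABLE ITSELF ABOUT A PREDICTABLE
CENTRE, frame-indexed.**  On the realised chain with its frame filtration of depth `n`, at frame step `i < n` (chain
slot `b = n-(i+1)`), for every `F (i+1)`-measurable bounded centre `Z`:
`oneStepVar κ b φ (x≤b) ≤ μ[(φ − Z)² ∣ F (i+1)] (x)` for a.e. path — conditional variance of the finer conditional
mean ≤ its conditional second moment about `Z` (`T4PathwiseCoupling.condExp_incr_sq_le_condExp_sq_sub`) ≤ the
conditional second moment of `φ` itself about `Z` (conditional Jensen at the finer level, then the tower property). -/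
theorem ae_oneStepVar_frame_le_condExp_sq_sub (ν : Measure (X 0)) [IsFiniteMeasure ν] (n : ℕ)
    {φ : (Π k, X k) → ℝ} (hφm : StronglyMeasurable φ) {R : ℝ} (hφR : ∀ x, |φ x| ≤ R) {i : ℕ} (hi : i < n)
    {Z : (Π k, X k) → ℝ} (hZm : StronglyMeasurable[frameFiltration X n (i + 1)] Z) {CZ : ℝ}
    (hZb : ∀ x, |Z x| ≤ CZ) :
    ∀ᵐ x ∂(Kernel.trajMeasure ν κ),
      oneStepVar κ (n - (i + 1)) φ (frestrictLe (n - (i + 1)) x) ≤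
        ((Kernel.trajMeasure ν κ)[fun x => (φ x - Z x) ^ 2 | frameFiltration X n (i + 1)]) x := by
  have hF := antitone_frameFiltration (X := X) n
  have hFle := frameFiltration_le (X := X) n
  have hφ : Integrable φ (Kernel.trajMeasure ν κ) := integrable_of_abs_le_const hφm hφR
  have h1 := condExp_incr_sq_frame_ae_eq (κ := κ) ν n hφm hφR hi
  have h2 := condExp_incr_sq_le_condExp_sq_sub (μ := Kernel.trajMeasure ν κ) hF hFle hφR i hZm hZb
  -- the centre is also `F i`-measurable (the frame filtration is antitone)
  have hZmi : StronglyMeasurable[frameFiltration X n i] Z := hZm.mono (hF (Nat.le_succ i))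
  have hZi : Integrable Z (Kernel.trajMeasure ν κ) :=
    integrable_of_abs_le_const (hZm.mono (hFle (i + 1))) hZb
  -- conditional Jensen at level `F i`: (μ[φ|F i] − Z)² ≤ μ[(φ − Z)²|F i] a.e.
  have hgZ : MemLp (fun x => φ x - Z x) 2 (Kernel.trajMeasure ν κ) :=
    MemLp.of_bound (hφm.aestronglyMeasurable.sub (hZm.mono (hFle (i + 1))).aestronglyMeasurable) (R + CZ)
      (ae_of_all _ fun x => by
        rw [Real.norm_eq_abs]
        exact (abs_sub _ _).trans (add_le_add (hφR x) (hZb x)))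
  have h3 := sq_condExp_le_condExp_sq (μ := Kernel.trajMeasure ν κ) (hFle i) hgZ
  have h3' : (Kernel.trajMeasure ν κ)[fun x => φ x - Z x | frameFiltration X n i] =ᵐ[Kernel.trajMeasure ν κ]
      fun x => ((Kernel.trajMeasure ν κ)[φ | frameFiltration X n i]) x - Z x := by
    have hs := condExp_sub hφ hZi (frameFiltration X n i)
    rw [condExp_of_stronglyMeasurable (hFle i) hZmi hZi] at hs
    exact hs
  have h34 : (fun x => (((Kernel.trajMeasure ν κ)[φ | frameFiltration X n i]) x - Z x) ^ 2)
      ≤ᵐ[Kernel.trajMeasure ν κ]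
        (Kernel.trajMeasure ν κ)[fun x => (φ x - Z x) ^ 2 | frameFiltration X n i] := by
    filter_upwards [h3, h3'] with x hx hx'
    rw [← hx']
    exact hx
  -- integrability of both sides, monotonicity of `μ[· | F (i+1)]`, tower property
  have hMZi : Integrable (fun x => (((Kernel.trajMeasure ν κ)[φ | frameFiltration X n i]) x - Z x) ^ 2)
      (Kernel.trajMeasure ν κ) := by
    refine integrable_sq_of_ae_abs_le (bu := R + CZ)
      ((stronglyMeasurable_condExp.mono (hFle i)).aestronglyMeasurable.sub
        (hZm.mono (hFle (i + 1))).aestronglyMeasurable) ?_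
    filter_upwards [ae_abs_condExp_le (μ := Kernel.trajMeasure ν κ) (m := frameFiltration X n i) hφR]
      with x hx
    exact (abs_sub _ _).trans (add_le_add hx (hZb x))
  have h4 := condExp_mono (m := frameFiltration X n (i + 1)) hMZi integrable_condExp h34
  have h5 := condExp_condExp_of_le (f := fun x => (φ x - Z x) ^ 2) (μ := Kernel.trajMeasure ν κ)
    (hF (Nat.le_succ i)) (hFle i)
  filter_upwards [h1, h2, h4, h5] with x hx1 hx2 hx4 hx5
  rw [← hx1]
  exact hx2.trans (hx4.trans hx5.le)

/-- [folklore] **ONE-STEP CONDITIONAL VARIANCE ≤ CONDITIONAL SECOND MOMENT OF THE OBSERVABLE ABOUT A PREDICTABLE CENTRE,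
chain-indexed.**  At chain slot `b`, for every measurable bounded centre `ctr` of the length-`b` history:
`oneStepVar κ b φ (x≤b) ≤ μ[(φ − ctr (·≤b))² ∣ piLE b] (x)` for a.e. path of the realised chain. -/
theorem ae_oneStepVar_le_condExp_sq_sub (ν : Measure (X 0)) [IsFiniteMeasure ν] (b : ℕ) {φ : (Π k, X k) → ℝ}
    (hφm : StronglyMeasurable φ) {R : ℝ} (hφR : ∀ x, |φ x| ≤ R)
    {ctr : (Π i : Iic b, X i) → ℝ} (hctrm : StronglyMeasurable ctr) {CZ : ℝ} (hctrb : ∀ h, |ctr h| ≤ CZ) :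
    ∀ᵐ x ∂(Kernel.trajMeasure ν κ), oneStepVar κ b φ (frestrictLe b x) ≤
      ((Kernel.trajMeasure ν κ)[fun x => (φ x - ctr (frestrictLe b x)) ^ 2 | piLE (X := X) b]) x := by
  have e1 : frameFiltration X (b + 1) (0 + 1) = piLE (X := X) b := by
    simp only [frameFiltration, Nat.zero_add, Nat.add_sub_cancel]
  have hZm : StronglyMeasurable[frameFiltration X (b + 1) (0 + 1)] (fun x : Π k, X k => ctr (frestrictLe b x)) := by
    rw [e1]; exact stronglyMeasurable_comp_frestrictLe hctrm
  have h := ae_oneStepVar_frame_le_condExp_sq_sub (κ := κ) ν (b + 1) hφm hφR (i := 0) (Nat.succ_pos b) hZm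
    (fun x => hctrb _)
  rw [e1] at h
  exact h

/-- [folklore] The history functional `h ↦ fiberMean κ b ψ h` integrates like `ψ` under the realised chain:
`∫ fiberMean κ b ψ (x≤b) dμ = ∫ ψ dμ` (it is a version of `μ[ψ | piLE b]`). -/
theorem integral_fiberMean_comp_frestrictLe (ν : Measure (X 0)) [IsFiniteMeasure ν] (b : ℕ) {ψ : (Π k, X k) → ℝ}
    (hψm : StronglyMeasurable ψ) {Rψ : ℝ} (hψR : ∀ x, |ψ x| ≤ Rψ) :
    ∫ x, fiberMean κ b ψ (frestrictLe b x) ∂(Kernel.trajMeasure ν κ) = ∫ x, ψ x ∂(Kernel.trajMeasure ν κ) := by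
  rw [← integral_congr_ae (condExp_piLE_ae_eq (κ := κ) ν b (integrable_of_abs_le_const hψm hψR))]
  exact integral_condExp ((piLE (X := X)).le b)

/-- [folklore] `0 ≤ fiberMean κ b (1_A) h ≤ 1` for the indicator of a measurable set of paths. -/
theorem fiberMean_indicator_mem_Icc (b : ℕ) {A : Set (Π k, X k)} (hA : MeasurableSet A) (h : Π i : Iic b, X i) :
    fiberMean κ b (A.indicator fun _ => (1 : ℝ)) h ∈ Set.Icc (0 : ℝ) 1 := by
  have h0 : 0 ≤ fiberMean κ b (A.indicator fun _ => (1 : ℝ)) h := by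
    rw [fiberMean_apply]
    exact integral_nonneg fun x => Set.indicator_nonneg (fun _ _ => zero_le_one) _
  have hm : StronglyMeasurable (A.indicator fun _ : Π k, X k => (1 : ℝ)) := stronglyMeasurable_const.indicator hA
  have h1 := abs_fiberMean_le (κ := κ) b hm (R := 1) (fun x => by
      by_cases hx : x ∈ A <;> simp [hx]) h
  exact ⟨h0, (le_abs_self _).trans h1⟩

/-- [folklore] **PATHWISE OSCILLATION OFF A BAD EVENT ⇒ ONE-STEP VARIANCE PROXY.**  At chain slot `b`: if for a.e. path
OUTSIDE a measurable bad event `Bad`, the observable ITSELF stays within `c (x≤b)` of a predictable centre,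
`|φ x − ctr (x≤b)| ≤ c (x≤b)` (`ctr`, `c ≥ 0` measurable functions of the length-`b` history, `|ctr| ≤ R ≥ |φ|`), then
`oneStepVar κ b φ (x≤b) ≤ min(c (x≤b), 2R)² + (2R)²·fiberMean κ b 1_Bad (x≤b)` for a.e. path: the predictable proxy
is the squared radius plus `(2R)²` times the CONDITIONAL PROBABILITY OF THE BAD EVENT GIVEN THE HISTORY.  (No
statement about conditional means is asked for: the transport from the observable to its conditional means is the
kernel's, by `ae_oneStepVar_le_condExp_sq_sub`.) -/
theorem ae_oneStepVar_le_of_pathwise_osc (ν : Measure (X 0)) [IsFiniteMeasure ν] (b : ℕ) {φ : (Π k, X k) → ℝ}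
    (hφm : StronglyMeasurable φ) {R : ℝ} (hφR : ∀ x, |φ x| ≤ R)
    {ctr c : (Π i : Iic b, X i) → ℝ} (hctrm : StronglyMeasurable ctr) (hctrb : ∀ h, |ctr h| ≤ R)
    (hcm : StronglyMeasurable c) (hc0 : ∀ h, 0 ≤ c h) {Bad : Set (Π k, X k)} (hBad : MeasurableSet Bad)
    (hoscP : ∀ᵐ x ∂(Kernel.trajMeasure ν κ), x ∉ Bad → |φ x - ctr (frestrictLe b x)| ≤ c (frestrictLe b x)) :
    ∀ᵐ x ∂(Kernel.trajMeasure ν κ), oneStepVar κ b φ (frestrictLe b x) ≤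
      (min (c (frestrictLe b x)) (2 * R)) ^ 2 +
        (2 * R) ^ 2 * fiberMean κ b (Bad.indicator fun _ => (1 : ℝ)) (frestrictLe b x) := by
  have h1 := ae_oneStepVar_le_condExp_sq_sub (κ := κ) ν b hφm hφR hctrm hctrb
  -- pointwise a.e.: (φ − ctr)² ≤ min(c, 2R)² + (2R)²·1_Bad
  have hdev : ∀ x, |φ x - ctr (frestrictLe b x)| ≤ 2 * R := fun x =>
    calc |φ x - ctr (frestrictLe b x)| ≤ |φ x| + |ctr (frestrictLe b x)| := abs_sub _ _
      _ ≤ R + R := add_le_add (hφR x) (hctrb _)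
      _ = 2 * R := by ring
  have hpt : (fun x => (φ x - ctr (frestrictLe b x)) ^ 2) ≤ᵐ[Kernel.trajMeasure ν κ]
      (fun x : Π k, X k => (min (c (frestrictLe b x)) (2 * R)) ^ 2) +
        fun x => (2 * R) ^ 2 * Bad.indicator (fun _ => (1 : ℝ)) x := by
    filter_upwards [hoscP] with x hx
    simp only [Pi.add_apply]
    by_cases hxB : x ∈ Bad
    · simp only [Set.indicator_of_mem hxB, mul_one]
      rw [← sq_abs]
      exact (pow_le_pow_left₀ (abs_nonneg (φ x - ctr (frestrictLe b x))) (hdev x) 2).trans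
        (le_add_of_nonneg_left (sq_nonneg _))
    · simp only [Set.indicator_of_notMem hxB, mul_zero, add_zero]
      rw [← sq_abs]
      exact pow_le_pow_left₀ (abs_nonneg (φ x - ctr (frestrictLe b x))) (le_min (hx hxB) (hdev x)) 2
  -- integrability
  have hGi : Integrable (fun x => (φ x - ctr (frestrictLe b x)) ^ 2) (Kernel.trajMeasure ν κ) :=
    integrable_sq_of_ae_abs_le
      (hφm.aestronglyMeasurable.sub (hctrm.comp_measurable (measurable_frestrictLe b)).aestronglyMeasurable)
      (ae_of_all _ hdev)
  have hH1m : StronglyMeasurable fun h : (Π i : Iic b, X i) => (min (c h) (2 * R)) ^ 2 :=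
    ((hcm.measurable.min measurable_const).pow_const 2).stronglyMeasurable
  have hH1b : ∀ h : (Π i : Iic b, X i), |(min (c h) (2 * R)) ^ 2| ≤ (2 * |R|) ^ 2 := fun h => by
    have hm : |min (c h) (2 * R)| ≤ 2 * |R| := by
      rcases min_choice (c h) (2 * R) with hc | hc <;> rw [hc]
      · rw [abs_of_nonneg (hc0 h)]
        have h' : c h ≤ 2 * R := hc ▸ min_le_right (c h) (2 * R)
        linarith [le_abs_self R]
      · rw [abs_mul, abs_two]
    rw [abs_pow]
    exact pow_le_pow_left₀ (abs_nonneg _) hm 2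
  have hH1m' : StronglyMeasurable fun x : Π k, X k => (min (c (frestrictLe b x)) (2 * R)) ^ 2 :=
    hH1m.comp_measurable (measurable_frestrictLe b)
  have hH1i : Integrable (fun x : Π k, X k => (min (c (frestrictLe b x)) (2 * R)) ^ 2) (Kernel.trajMeasure ν κ) :=
    integrable_of_abs_le_const hH1m' (fun x => hH1b (frestrictLe b x))
  have hIndm : StronglyMeasurable (Bad.indicator fun _ : Π k, X k => (1 : ℝ)) :=
    stronglyMeasurable_const.indicator hBad
  have hIndb : ∀ x, |Bad.indicator (fun _ : Π k, X k => (1 : ℝ)) x| ≤ 1 := fun x => by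
    by_cases hx : x ∈ Bad <;> simp [hx]
  have hIndi : Integrable (Bad.indicator fun _ : Π k, X k => (1 : ℝ)) (Kernel.trajMeasure ν κ) :=
    integrable_of_abs_le_const hIndm hIndb
  have hH2i : Integrable (fun x => (2 * R) ^ 2 * Bad.indicator (fun _ => (1 : ℝ)) x) (Kernel.trajMeasure ν κ) :=
    hIndi.const_mul _
  have h2 := condExp_mono (m := piLE (X := X) b) hGi (hH1i.add hH2i) hpt
  -- evaluate `μ[H | piLE b]`
  have h3 := condExp_add hH1i hH2i (piLE (X := X) b) (μ := Kernel.trajMeasure ν κ)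
  have h4 : (Kernel.trajMeasure ν κ)[fun x : Π k, X k => (min (c (frestrictLe b x)) (2 * R)) ^ 2 | piLE (X := X) b]
      = fun x => (min (c (frestrictLe b x)) (2 * R)) ^ 2 :=
    condExp_of_stronglyMeasurable ((piLE (X := X)).le b) (stronglyMeasurable_comp_frestrictLe hH1m) hH1i
  have h5 : (Kernel.trajMeasure ν κ)[fun x => (2 * R) ^ 2 * Bad.indicator (fun _ => (1 : ℝ)) x | piLE (X := X) b]
      =ᵐ[Kernel.trajMeasure ν κ] fun x =>
        (2 * R) ^ 2 * fiberMean κ b (Bad.indicator fun _ => (1 : ℝ)) (frestrictLe b x) := by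
    have hs := condExp_smul ((2 * R) ^ 2) (Bad.indicator fun _ : Π k, X k => (1 : ℝ)) (piLE (X := X) b)
      (μ := Kernel.trajMeasure ν κ)
    filter_upwards [hs, condExp_piLE_ae_eq (κ := κ) ν b hIndi] with x hx hx'
    simp only [Pi.smul_apply, smul_eq_mul] at hx
    rw [show (fun x => (2 * R) ^ 2 * Bad.indicator (fun _ => (1 : ℝ)) x) =
      (2 * R) ^ 2 • Bad.indicator (fun _ : Π k, X k => (1 : ℝ)) from rfl, hx, hx']
  filter_upwards [h1, h2, h3, h5] with x hx1 hx2 hx3 hx5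
  refine hx1.trans (hx2.trans (le_of_eq ?_))
  rw [hx3, Pi.add_apply, h4, hx5]

end Pathwise

/-! ## §3  The end-to-end sharpened-Azuma bound under irregular nesting, on the realised chain and under a given
path law, in variance-proxy form and in oscillation form -/

section EndToEnd

variable {X : ℕ → Type*} [∀ n, MeasurableSpace (X n)]
variable {κ : (b : ℕ) → Kernel (Π i : Iic b, X i) (X (b + 1))} [∀ b, IsMarkovKernel (κ b)]
variable {ι : Type*}

/-- [folklore] Re-indexing a sum over frame steps `i < n` as a sum over chain slots `b = n-(i+1) < n`. -/
theorem sum_range_reindex {M : Type*} [AddCommMonoid M] (n : ℕ) (G : ℕ → M) :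
    ∑ i ∈ range n, G (n - (i + 1)) = ∑ b ∈ range n, G b := by
  rw [← Finset.sum_range_reflect G n]
  refine Finset.sum_congr rfl fun i hi => ?_
  have : n - 1 - i = n - (i + 1) := by omega
  rw [this]

/-- [folklore] Re-indexing the per-level slot counts from frame steps to chain slots. -/
theorem card_filter_range_reindex (n : ℕ) (lvl : ℕ → ℕ) (m : ℕ) :
    ((range n).filter fun i => lvl (n - (i + 1)) = m).card = ((range n).filter fun b => lvl b = m).card := by
  rw [Finset.card_filter, Finset.card_filter]
  exact sum_range_reindex n (fun b => if lvl b = m then 1 else 0)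

/-- [folklore] A.e. version of `T4CouplingChain.incrementVarProxy_of_oneStepVar`: chain-indexed predictable functions
`W b` dominating the one-step conditional variances `oneStepVar κ b φ (x≤b)` for a.e. path are increment-variance
proxies for the frame filtration. -/
theorem incrementVarProxy_of_oneStepVar_ae (ν : Measure (X 0)) [IsFiniteMeasure ν] (n : ℕ)
    {φ : (Π k, X k) → ℝ} (hφm : StronglyMeasurable φ) {R : ℝ} (hφR : ∀ x, |φ x| ≤ R)
    {W : (b : ℕ) → (Π i : Iic b, X i) → ℝ}
    (hW : ∀ b < n, ∀ᵐ x ∂(Kernel.trajMeasure ν κ), oneStepVar κ b φ (frestrictLe b x) ≤ W b (frestrictLe b x)) :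
    IncrementVarProxy (Kernel.trajMeasure ν κ) (frameFiltration X n) φ n
      (fun i x => W (n - (i + 1)) (frestrictLe (n - (i + 1)) x)) := by
  intro i hi
  filter_upwards [condExp_incr_sq_frame_ae_eq ν n hφm hφR hi, hW (n - (i + 1)) (by omega)] with x hx hWx
  rw [hx]
  exact hWx

open scoped Classical in
/-- [folklore] Measurability of the multiplicity weight `h ↦ a^{#{j ∈ J : h ∈ G j}}` of a finite family of measurable
events. -/
theorem measurable_pow_card_filter {α : Type*} [MeasurableSpace α] (J : Finset ι) {G : ι → Set α}
    (hG : ∀ j ∈ J, MeasurableSet (G j)) (a : ℝ) :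
    Measurable fun h => a ^ (J.filter fun j => h ∈ G j).card := by
  have heq : (fun h => a ^ (J.filter fun j => h ∈ G j).card) =
      fun h => ∏ j ∈ J, (1 + (a - 1) * (G j).indicator (fun _ => (1 : ℝ)) h) := by
    funext h
    rw [prod_one_add_mul_indicator_eq_pow, add_sub_cancel]
  rw [heq]
  exact Finset.measurable_prod J fun j hj =>
    measurable_const.add (measurable_const.mul (measurable_const.indicator (hG j hj)))

open scoped Classical in
/-- [folklore] **THE END-TO-END BOUND UNDER IRREGULAR NESTING ON THE REALISED CHAIN, VARIANCE-PROXY FORM** — MI-F1-K's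
kernel form (K-nest) discharged down to chain-indexed per-step data.  Backward-presented block-spin chain with
endpoint law `ν` (unit lattice) and fibre kernels `κ b`; bounded unit-lattice observable `φ` (`piLE n`-measurable,
`|φ| ≤ R`); chain-indexed predictable proxies `W b` with `oneStepVar κ b φ (x≤b) ≤ W b (x≤b)` a.e.; slot levels
`lvl b < K` with per-level slot counts `#{b < n : lvl b = m} ≤ N₀·Λ^m`; revealed creation events `G b j`
(`j ∈ J b`, measurable sets of length-`b` histories) with PRODUCT DOMINATION `μ(⋂_{j∈S} {x≤b ∈ G b j}) ≤ μ(Ω)·∏ ε b j`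
(binder `hdom`; dischargers in §1) and level budget `Σ_j ε b j ≤ E`; NESTING-REGULARITY DOMINATION of the proxies
`W b h ≤ C²·(θ²)^{lvl b}·κ₀^{#{j : h ∈ G b j}} + U b h` with an additive locality channel of total first moment
`Σ_b ∫ U b (x≤b) ≤ Utot`.  Then for `|t|·2R ≤ 1`, `B > 0`, `0 ≤ g₀ ≤ Cg` measurable on the unit lattice:
`∫ g₀(x 0)·e^{tφ} dμ ≤ e^{t²B}·∫ g₀·e^{t·towerMean κ φ} dν + e^{|t|R}·Cg·B⁻¹·(N₀·C²·μ(Ω)·e^{(κ₀−1)E}·C_0(Λθ²) + Utot)`,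
UNIFORMLY IN THE DEPTH `n` (`C_0 = T4TubeBudget.geomPolyConst 0`).  Proof: `T4PathwiseCoupling.
integral_mul_exp_le_uniform_of_nesting_add` on the frame filtration, re-indexed `i ↦ b = n-(i+1)`, and
`T4CouplingChain.integral_mul_exp_condExp_endpoint_eq`. -/
theorem integral_mul_exp_le_uniform_of_nesting_chain (ν : Measure (X 0)) [IsFiniteMeasure ν] (n : ℕ)
    {φ : (Π k, X k) → ℝ} (hφn : StronglyMeasurable[piLE (X := X) n] φ) {R : ℝ} (hφR : ∀ x, |φ x| ≤ R)
    {W : (b : ℕ) → (Π i : Iic b, X i) → ℝ} (hWm : ∀ b, StronglyMeasurable (W b)) {Vmax : ℝ}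
    (hWb : ∀ b < n, ∀ h, |W b h| ≤ Vmax)
    (hW : ∀ b < n, ∀ᵐ x ∂(Kernel.trajMeasure ν κ), oneStepVar κ b φ (frestrictLe b x) ≤ W b (frestrictLe b x))
    (lvl : ℕ → ℕ) {N₀ Λ θ : ℝ} {K : ℕ} (hN₀ : 0 ≤ N₀) (hΛ : 0 ≤ Λ) (hr : Λ * θ ^ 2 < 1)
    (hlvl : ∀ b < n, lvl b < K)
    (hcard : ∀ m < K, (((range n).filter fun b => lvl b = m).card : ℝ) ≤ N₀ * Λ ^ m)
    (J : ℕ → Finset ι) (G : (b : ℕ) → ι → Set (Π i : Iic b, X i))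
    (hG : ∀ b < n, ∀ j ∈ J b, MeasurableSet (G b j))
    {ε : ℕ → ι → ℝ} (hε : ∀ b < n, ∀ j ∈ J b, 0 ≤ ε b j) {E : ℝ} (hE : ∀ b < n, ∑ j ∈ J b, ε b j ≤ E)
    {κ₀ : ℝ} (hκ₀ : 1 ≤ κ₀)
    (hdom : ∀ b < n, ∀ S ⊆ J b,
      (Kernel.trajMeasure ν κ).real (⋂ j ∈ S, frestrictLe b ⁻¹' G b j) ≤
        (Kernel.trajMeasure ν κ).real Set.univ * ∏ j ∈ S, ε b j)
    (C : ℝ) {U : (b : ℕ) → (Π i : Iic b, X i) → ℝ} (hUm : ∀ b, StronglyMeasurable (U b)) {Umax : ℝ}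
    (hUb : ∀ b < n, ∀ h, |U b h| ≤ Umax) {Utot : ℝ}
    (hU : ∑ b ∈ range n, ∫ x, U b (frestrictLe b x) ∂(Kernel.trajMeasure ν κ) ≤ Utot)
    (hWdom : ∀ b < n, ∀ h, W b h ≤
      C ^ 2 * (θ ^ 2) ^ lvl b * κ₀ ^ ((J b).filter fun j => h ∈ G b j).card + U b h)
    {t : ℝ} (ht : |t| * (2 * R) ≤ 1) {B : ℝ} (hB : 0 < B) {g₀ : X 0 → ℝ} (hg : StronglyMeasurable g₀)
    (hg0 : ∀ z, 0 ≤ g₀ z) {Cg : ℝ} (hCg : 0 ≤ Cg) (hgC : ∀ z, g₀ z ≤ Cg) :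
    ∫ x, g₀ (x 0) * Real.exp (t * φ x) ∂(Kernel.trajMeasure ν κ) ≤
      Real.exp (t ^ 2 * B) * ∫ z, g₀ z * Real.exp (t * towerMean κ φ z) ∂ν +
        Real.exp (|t| * R) *
          (Cg * (B⁻¹ * (N₀ * (C ^ 2 * ((Kernel.trajMeasure ν κ).real Set.univ * Real.exp ((κ₀ - 1) * E))) *
            geomPolyConst 0 (Λ * θ ^ 2) + Utot))) := by
  have hφm : StronglyMeasurable φ := hφn.mono ((piLE (X := X)).le n)
  have hU' : ∑ i ∈ range n, ∫ x, U (n - (i + 1)) (frestrictLe (n - (i + 1)) x) ∂(Kernel.trajMeasure ν κ) ≤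
      Utot := by
    rw [sum_range_reindex n (fun b => ∫ x, U b (frestrictLe b x) ∂(Kernel.trajMeasure ν κ))]
    exact hU
  have hcard' : ∀ m < K, (((range n).filter fun i => lvl (n - (i + 1)) = m).card : ℝ) ≤ N₀ * Λ ^ m := by
    intro m hm
    rw [card_filter_range_reindex n lvl m]
    exact hcard m hm
  have hmain := integral_mul_exp_le_uniform_of_nesting_add (μ := Kernel.trajMeasure ν κ) (ι := ι)
    (antitone_frameFiltration n) (frameFiltration_le n) (stronglyMeasurable_frame_zero hφn) hφR n
    (V := fun i x => W (n - (i + 1)) (frestrictLe (n - (i + 1)) x)) (Vmax := Vmax)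
    (fun i _ => stronglyMeasurable_frameProxy hWm n i) (fun i hi => ae_abs_frameProxy_le n hWb i hi)
    (incrementVarProxy_of_oneStepVar_ae ν n hφm hφR hW)
    (fun i => lvl (n - (i + 1))) hN₀ hΛ hr (fun i hi => hlvl _ (by omega)) hcard'
    (fun i => J (n - (i + 1))) (fun i j => frestrictLe (n - (i + 1)) ⁻¹' G (n - (i + 1)) j)
    (fun i hi j hj => measurable_frestrictLe _ (hG _ (by omega) j hj))
    (ε := fun i => ε (n - (i + 1))) (fun i hi j hj => hε _ (by omega) j hj) (fun i hi => hE _ (by omega))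
    hκ₀ (fun i hi S hS => hdom _ (by omega) S hS) C
    (U := fun i x => U (n - (i + 1)) (frestrictLe (n - (i + 1)) x)) (Umax := Umax)
    (fun i _ => stronglyMeasurable_frameProxy hUm n i) (fun i hi => ae_abs_frameProxy_le n hUb i hi)
    hU' (fun i hi => ae_of_all _ fun x => hWdom _ (by omega) _)
    ht hB (stronglyMeasurable_endpoint hg n n) (fun x => hg0 (x 0)) hCg (fun x => hgC (x 0))
  rw [integral_mul_exp_condExp_endpoint_eq ν n hφm hφR hg t] at hmain
  exact hmain

open scoped Classical in
/-- [folklore] **THE END-TO-END BOUND UNDER IRREGULAR NESTING, OSCILLATION FORM ((O)+(J)+(L) of the record)** — the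
form in which the two remaining inputs of NE1′ are a.e. statements about consecutive conditional means and a
product-domination statement about revealed creation events.  Data as in
`integral_mul_exp_le_uniform_of_nesting_chain`, but instead of proxies: predictable CENTRES `ctr b` (`|ctr b| ≤ R`)
and LOCALITY RADII `0 ≤ ℓ b ≤ ℓmax` (measurable functions of the length-`b` history) with
(O) `|fiberMean κ (b+1) φ (x≤(b+1)) − ctr b (x≤b)| ≤ C·θ^{lvl b}·κ₁^{#{j ∈ J b : x≤b ∈ G b j}} + ℓ b (x≤b)` for a.e.
path (the finer conditional mean moves by at most the nesting-regularity radius — geometric in the level, inflated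
by `κ₁` per revealed creation event within reach — plus a locality error), (J) product domination `hdom` with level
budget `E`, (L) `Σ_{b<n} ∫ ℓ b (x≤b)² dμ ≤ Ltot`.  Then for `|t|·2R ≤ 1`, `B > 0`, `0 ≤ g₀ ≤ Cg`:
`∫ g₀(x 0)·e^{tφ} dμ ≤ e^{t²B}·∫ g₀·e^{t·towerMean κ φ} dν + e^{|t|R}·Cg·B⁻¹·(N₀·2C²·μ(Ω)·e^{(κ₁²−1)E}·C_0(Λθ²) + 2Ltot)`,
uniformly in `n`.  Proof: §2 gives `oneStepVar ≤ (min(radius, 2R))²` a.e.; `(a+ℓ)² ≤ 2a²+2ℓ²`; the proxy form with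
`κ₀ = κ₁²`. -/
theorem integral_mul_exp_le_uniform_of_oscillation (ν : Measure (X 0)) [IsFiniteMeasure ν] (n : ℕ)
    {φ : (Π k, X k) → ℝ} (hφn : StronglyMeasurable[piLE (X := X) n] φ) {R : ℝ} (hφR : ∀ x, |φ x| ≤ R)
    (lvl : ℕ → ℕ) {N₀ Λ θ : ℝ} {K : ℕ} (hN₀ : 0 ≤ N₀) (hΛ : 0 ≤ Λ) (hθ : 0 ≤ θ) (hr : Λ * θ ^ 2 < 1)
    (hlvl : ∀ b < n, lvl b < K)
    (hcard : ∀ m < K, (((range n).filter fun b => lvl b = m).card : ℝ) ≤ N₀ * Λ ^ m)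
    (J : ℕ → Finset ι) (G : (b : ℕ) → ι → Set (Π i : Iic b, X i))
    (hG : ∀ b, ∀ j ∈ J b, MeasurableSet (G b j))
    {ε : ℕ → ι → ℝ} (hε : ∀ b < n, ∀ j ∈ J b, 0 ≤ ε b j) {E : ℝ} (hE : ∀ b < n, ∑ j ∈ J b, ε b j ≤ E)
    {κ₁ : ℝ} (hκ₁ : 1 ≤ κ₁)
    (hdom : ∀ b < n, ∀ S ⊆ J b,
      (Kernel.trajMeasure ν κ).real (⋂ j ∈ S, frestrictLe b ⁻¹' G b j) ≤
        (Kernel.trajMeasure ν κ).real Set.univ * ∏ j ∈ S, ε b j)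
    {C : ℝ} (hC : 0 ≤ C)
    {ctr : (b : ℕ) → (Π i : Iic b, X i) → ℝ} (hctrm : ∀ b, StronglyMeasurable (ctr b))
    (hctrb : ∀ b < n, ∀ h, |ctr b h| ≤ R)
    {ℓ : (b : ℕ) → (Π i : Iic b, X i) → ℝ} (hℓm : ∀ b, StronglyMeasurable (ℓ b)) (hℓ0 : ∀ b h, 0 ≤ ℓ b h)
    {ℓmax : ℝ} (hℓb : ∀ b < n, ∀ h, ℓ b h ≤ ℓmax) {Ltot : ℝ}
    (hL : ∑ b ∈ range n, ∫ x, ℓ b (frestrictLe b x) ^ 2 ∂(Kernel.trajMeasure ν κ) ≤ Ltot)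
    (hosc : ∀ b < n, ∀ᵐ x ∂(Kernel.trajMeasure ν κ),
      |fiberMean κ (b + 1) φ (frestrictLe (b + 1) x) - ctr b (frestrictLe b x)| ≤
        C * θ ^ lvl b * κ₁ ^ ((J b).filter fun j => frestrictLe b x ∈ G b j).card + ℓ b (frestrictLe b x))
    {t : ℝ} (ht : |t| * (2 * R) ≤ 1) {B : ℝ} (hB : 0 < B) {g₀ : X 0 → ℝ} (hg : StronglyMeasurable g₀)
    (hg0 : ∀ z, 0 ≤ g₀ z) {Cg : ℝ} (hCg : 0 ≤ Cg) (hgC : ∀ z, g₀ z ≤ Cg) :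
    ∫ x, g₀ (x 0) * Real.exp (t * φ x) ∂(Kernel.trajMeasure ν κ) ≤
      Real.exp (t ^ 2 * B) * ∫ z, g₀ z * Real.exp (t * towerMean κ φ z) ∂ν +
        Real.exp (|t| * R) *
          (Cg * (B⁻¹ * (N₀ * (2 * C ^ 2 * ((Kernel.trajMeasure ν κ).real Set.univ *
            Real.exp ((κ₁ ^ 2 - 1) * E))) * geomPolyConst 0 (Λ * θ ^ 2) + 2 * Ltot))) := by
  have hφm : StronglyMeasurable φ := hφn.mono ((piLE (X := X)).le n)
  have hκpos : 0 ≤ κ₁ := zero_le_one.trans hκ₁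
  -- the nesting-regularity radius `rad`, the proxy `W = (min(rad, 2R))²` and the locality channel `U = 2ℓ²`,
  -- introduced as opaque functions with defining equations
  obtain ⟨rad, hrad⟩ : ∃ rad : (b : ℕ) → (Π i : Iic b, X i) → ℝ, ∀ b h,
      rad b h = C * θ ^ lvl b * κ₁ ^ ((J b).filter fun j => h ∈ G b j).card + ℓ b h := ⟨_, fun _ _ => rfl⟩
  obtain ⟨W, hWdef⟩ : ∃ W : (b : ℕ) → (Π i : Iic b, X i) → ℝ, ∀ b h, W b h = (min (rad b h) (2 * R)) ^ 2 :=
    ⟨_, fun _ _ => rfl⟩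
  obtain ⟨U, hUdef⟩ : ∃ U : (b : ℕ) → (Π i : Iic b, X i) → ℝ, ∀ b h, U b h = 2 * ℓ b h ^ 2 :=
    ⟨_, fun _ _ => rfl⟩
  have hrad0 : ∀ b h, 0 ≤ rad b h := fun b h => by
    rw [hrad]
    exact add_nonneg (mul_nonneg (mul_nonneg hC (pow_nonneg hθ _)) (pow_nonneg hκpos _)) (hℓ0 b h)
  have hradm : ∀ b, Measurable (rad b) := fun b => by
    rw [funext (hrad b)]
    exact (measurable_const.mul (measurable_pow_card_filter (J b) (hG b) κ₁)).add (hℓm b).measurable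
  have hcm : ∀ b, StronglyMeasurable (fun h => min (rad b h) (2 * R)) := fun b =>
    ((hradm b).min measurable_const).stronglyMeasurable
  have hWm : ∀ b, StronglyMeasurable (W b) := fun b => by
    rw [funext (hWdef b)]
    exact (hcm b).pow 2
  have hUm : ∀ b, StronglyMeasurable (U b) := fun b => by
    rw [funext (hUdef b)]
    exact stronglyMeasurable_const.mul ((hℓm b).pow 2)
  have hR : ∀ b < n, ∀ h : (Π i : Iic b, X i), 0 ≤ R := fun b hb h => (abs_nonneg _).trans (hctrb b hb h)
  have hmin0 : ∀ b < n, ∀ h, 0 ≤ min (rad b h) (2 * R) := fun b hb h =>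
    le_min (hrad0 b h) (by linarith [hR b hb h])
  have hWb : ∀ b < n, ∀ h, |W b h| ≤ (2 * R) ^ 2 := by
    intro b hb h
    rw [hWdef, abs_of_nonneg (sq_nonneg _)]
    exact pow_le_pow_left₀ (hmin0 b hb h) (min_le_right _ _) 2
  have hUb : ∀ b < n, ∀ h, |U b h| ≤ 2 * ℓmax ^ 2 := by
    intro b hb h
    rw [hUdef, abs_of_nonneg (mul_nonneg two_pos.le (sq_nonneg _))]
    exact mul_le_mul_of_nonneg_left (pow_le_pow_left₀ (hℓ0 b h) (hℓb b hb h) 2) two_pos.le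
  have hUtot : ∑ b ∈ range n, ∫ x, U b (frestrictLe b x) ∂(Kernel.trajMeasure ν κ) ≤ 2 * Ltot := by
    have hUint : ∀ b, ∫ x, U b (frestrictLe b x) ∂(Kernel.trajMeasure ν κ) =
        2 * ∫ x, ℓ b (frestrictLe b x) ^ 2 ∂(Kernel.trajMeasure ν κ) := by
      intro b
      rw [← integral_const_mul]
      exact integral_congr_ae (ae_of_all _ fun x => hUdef b _)
    rw [Finset.sum_congr rfl fun b _ => hUint b, ← mul_sum]
    exact mul_le_mul_of_nonneg_left hL two_pos.le
  -- (O) ⇒ a.e. domination of the one-step variances by W (§2)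
  have hW : ∀ b < n, ∀ᵐ x ∂(Kernel.trajMeasure ν κ),
      oneStepVar κ b φ (frestrictLe b x) ≤ W b (frestrictLe b x) := by
    intro b hb
    have hosc' : ∀ᵐ x ∂(Kernel.trajMeasure ν κ),
        |fiberMean κ (b + 1) φ (frestrictLe (b + 1) x) - ctr b (frestrictLe b x)| ≤
          min (rad b (frestrictLe b x)) (2 * R) := by
      filter_upwards [hosc b hb] with x hx
      refine le_min (by rw [hrad]; exact hx) ?_
      calc |fiberMean κ (b + 1) φ (frestrictLe (b + 1) x) - ctr b (frestrictLe b x)|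
          ≤ |fiberMean κ (b + 1) φ (frestrictLe (b + 1) x)| + |ctr b (frestrictLe b x)| := abs_sub _ _
        _ ≤ R + R := add_le_add (abs_fiberMean_le (b + 1) hφm hφR _) (hctrb b hb _)
        _ = 2 * R := by ring
    have hcb : ∀ h, |min (rad b h) (2 * R)| ≤ |2 * R| := fun h => by
      rw [abs_of_nonneg (hmin0 b hb h)]
      exact (min_le_right _ _).trans (le_abs_self _)
    have h := ae_oneStepVar_le_sq_of_osc (κ := κ) ν b hφm hφR (hctrm b) (hctrb b hb) (hcm b) hcb hosc'
    filter_upwards [h] with x hx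
    rw [hWdef]
    exact hx
  -- W ≤ (√2·C)²(θ²)^{lvl}(κ₁²)^{N} + U pointwise
  have hWdom : ∀ b < n, ∀ h, W b h ≤
      (Real.sqrt 2 * C) ^ 2 * (θ ^ 2) ^ lvl b * (κ₁ ^ 2) ^ ((J b).filter fun j => h ∈ G b j).card + U b h := by
    intro b hb h
    have h1 : W b h ≤ rad b h ^ 2 := by
      rw [hWdef]
      exact pow_le_pow_left₀ (hmin0 b hb h) (min_le_left _ _) 2
    have h2 : rad b h ^ 2 ≤ 2 * (C * θ ^ lvl b * κ₁ ^ ((J b).filter fun j => h ∈ G b j).card) ^ 2 +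
        2 * ℓ b h ^ 2 := by
      rw [hrad]
      nlinarith [sq_nonneg (C * θ ^ lvl b * κ₁ ^ ((J b).filter fun j => h ∈ G b j).card - ℓ b h)]
    have h3 : 2 * (C * θ ^ lvl b * κ₁ ^ ((J b).filter fun j => h ∈ G b j).card) ^ 2 =
        (Real.sqrt 2 * C) ^ 2 * (θ ^ 2) ^ lvl b * (κ₁ ^ 2) ^ ((J b).filter fun j => h ∈ G b j).card := by
      rw [mul_pow (Real.sqrt 2), Real.sq_sqrt (by norm_num : (0 : ℝ) ≤ 2), ← pow_mul, ← pow_mul,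
        mul_comm 2 (lvl b), mul_comm 2 ((J b).filter fun j => h ∈ G b j).card, pow_mul, pow_mul]
      ring
    rw [hUdef]
    linarith [h1, h2, h3.le, h3.ge]
  have hκ₀ : 1 ≤ κ₁ ^ 2 := one_le_pow₀ hκ₁
  have hmain := integral_mul_exp_le_uniform_of_nesting_chain (κ := κ) ν n hφn hφR hWm hWb hW lvl hN₀ hΛ hr
    hlvl hcard J G (fun b _ => hG b) hε hE hκ₀ hdom (Real.sqrt 2 * C) hUm hUb hUtot hWdom ht hB hg hg0 hCg hgC
  rw [mul_pow (Real.sqrt 2), Real.sq_sqrt (by norm_num : (0 : ℝ) ≤ 2)] at hmain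
  exact hmain

end EndToEnd

/-! ## §3b  The end-to-end bound in PATHWISE-OSCILLATION form, on the realised chain -/

section PathwiseEndToEnd

variable {X : ℕ → Type*} [∀ n, MeasurableSpace (X n)]
variable {κ : (b : ℕ) → Kernel (Π i : Iic b, X i) (X (b + 1))} [∀ b, IsMarkovKernel (κ b)]
variable {ι : Type*}

open scoped Classical in
/-- [folklore] **THE END-TO-END BOUND UNDER IRREGULAR NESTING, PATHWISE-OSCILLATION FORM ((O″)+(P)+(J)+(L) of the
record).**  Data as in `integral_mul_exp_le_uniform_of_oscillation`, but hypothesis (O) on consecutive conditional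
means is replaced by a statement about the OBSERVABLE ITSELF: measurable BAD EVENTS `Bad b` of paths with summable
probabilities (P) `Σ_{b<n} μ(Bad b) ≤ Ptot`, and (O″) for a.e. path OUTSIDE `Bad b`,
`|φ x − ctr b (x≤b)| ≤ C·θ^{lvl b}·κ₁^{#{j ∈ J b : x≤b ∈ G b j}} + ℓ b (x≤b)` — the observable is pinned by the
length-`b` history to within the nesting-regularity radius (inflated per revealed creation event within reach) plus a
locality radius, except on the bad event.  Then for `|t|·2R ≤ 1`, `B > 0`, `0 ≤ g₀ ≤ Cg`:
`∫ g₀(x 0)·e^{tφ} dμ ≤ e^{t²B}·∫ g₀·e^{t·towerMean κ φ} dν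
   + e^{|t|R}·Cg·B⁻¹·(N₀·2C²·μ(Ω)·e^{(κ₁²−1)E}·C_0(Λθ²) + (2Ltot + (2R)²·Ptot))`, uniformly in `n`.
Proof: §2b gives the predictable proxy `min(radius,2R)² + (2R)²·fiberMean κ b 1_{Bad b}` a.e.; the conditional bad
probabilities ride in the additive locality channel, their first moments summing to `Σ_b μ(Bad b)`. -/
theorem integral_mul_exp_le_uniform_of_pathwiseOsc (ν : Measure (X 0)) [IsFiniteMeasure ν] (n : ℕ)
    {φ : (Π k, X k) → ℝ} (hφn : StronglyMeasurable[piLE (X := X) n] φ) {R : ℝ} (hφR : ∀ x, |φ x| ≤ R)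
    (lvl : ℕ → ℕ) {N₀ Λ θ : ℝ} {K : ℕ} (hN₀ : 0 ≤ N₀) (hΛ : 0 ≤ Λ) (hθ : 0 ≤ θ) (hr : Λ * θ ^ 2 < 1)
    (hlvl : ∀ b < n, lvl b < K)
    (hcard : ∀ m < K, (((range n).filter fun b => lvl b = m).card : ℝ) ≤ N₀ * Λ ^ m)
    (J : ℕ → Finset ι) (G : (b : ℕ) → ι → Set (Π i : Iic b, X i))
    (hG : ∀ b, ∀ j ∈ J b, MeasurableSet (G b j))
    {ε : ℕ → ι → ℝ} (hε : ∀ b < n, ∀ j ∈ J b, 0 ≤ ε b j) {E : ℝ} (hE : ∀ b < n, ∑ j ∈ J b, ε b j ≤ E)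
    {κ₁ : ℝ} (hκ₁ : 1 ≤ κ₁)
    (hdom : ∀ b < n, ∀ S ⊆ J b,
      (Kernel.trajMeasure ν κ).real (⋂ j ∈ S, frestrictLe b ⁻¹' G b j) ≤
        (Kernel.trajMeasure ν κ).real Set.univ * ∏ j ∈ S, ε b j)
    {C : ℝ} (hC : 0 ≤ C)
    {ctr : (b : ℕ) → (Π i : Iic b, X i) → ℝ} (hctrm : ∀ b, StronglyMeasurable (ctr b))
    (hctrb : ∀ b < n, ∀ h, |ctr b h| ≤ R)
    {ℓ : (b : ℕ) → (Π i : Iic b, X i) → ℝ} (hℓm : ∀ b, StronglyMeasurable (ℓ b)) (hℓ0 : ∀ b h, 0 ≤ ℓ b h)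
    {ℓmax : ℝ} (hℓb : ∀ b < n, ∀ h, ℓ b h ≤ ℓmax) {Ltot : ℝ}
    (hL : ∑ b ∈ range n, ∫ x, ℓ b (frestrictLe b x) ^ 2 ∂(Kernel.trajMeasure ν κ) ≤ Ltot)
    (Bad : ℕ → Set (Π k, X k)) (hBad : ∀ b, MeasurableSet (Bad b)) {Ptot : ℝ}
    (hP : ∑ b ∈ range n, (Kernel.trajMeasure ν κ).real (Bad b) ≤ Ptot)
    (hoscP : ∀ b < n, ∀ᵐ x ∂(Kernel.trajMeasure ν κ), x ∉ Bad b →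
      |φ x - ctr b (frestrictLe b x)| ≤
        C * θ ^ lvl b * κ₁ ^ ((J b).filter fun j => frestrictLe b x ∈ G b j).card + ℓ b (frestrictLe b x))
    {t : ℝ} (ht : |t| * (2 * R) ≤ 1) {B : ℝ} (hB : 0 < B) {g₀ : X 0 → ℝ} (hg : StronglyMeasurable g₀)
    (hg0 : ∀ z, 0 ≤ g₀ z) {Cg : ℝ} (hCg : 0 ≤ Cg) (hgC : ∀ z, g₀ z ≤ Cg) :
    ∫ x, g₀ (x 0) * Real.exp (t * φ x) ∂(Kernel.trajMeasure ν κ) ≤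
      Real.exp (t ^ 2 * B) * ∫ z, g₀ z * Real.exp (t * towerMean κ φ z) ∂ν +
        Real.exp (|t| * R) *
          (Cg * (B⁻¹ * (N₀ * (2 * C ^ 2 * ((Kernel.trajMeasure ν κ).real Set.univ *
            Real.exp ((κ₁ ^ 2 - 1) * E))) * geomPolyConst 0 (Λ * θ ^ 2) + (2 * Ltot + (2 * R) ^ 2 * Ptot)))) := by
  have hφm : StronglyMeasurable φ := hφn.mono ((piLE (X := X)).le n)
  have hκpos : 0 ≤ κ₁ := zero_le_one.trans hκ₁
  -- radius, conditional bad probability, proxy and locality channel as opaque functions with defining equations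
  obtain ⟨rad, hrad⟩ : ∃ rad : (b : ℕ) → (Π i : Iic b, X i) → ℝ, ∀ b h,
      rad b h = C * θ ^ lvl b * κ₁ ^ ((J b).filter fun j => h ∈ G b j).card + ℓ b h := ⟨_, fun _ _ => rfl⟩
  obtain ⟨pB, hpB⟩ : ∃ pB : (b : ℕ) → (Π i : Iic b, X i) → ℝ, ∀ b h,
      pB b h = fiberMean κ b ((Bad b).indicator fun _ => (1 : ℝ)) h := ⟨_, fun _ _ => rfl⟩
  obtain ⟨W, hWdef⟩ : ∃ W : (b : ℕ) → (Π i : Iic b, X i) → ℝ, ∀ b h,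
      W b h = (min (rad b h) (2 * R)) ^ 2 + (2 * R) ^ 2 * pB b h := ⟨_, fun _ _ => rfl⟩
  obtain ⟨U, hUdef⟩ : ∃ U : (b : ℕ) → (Π i : Iic b, X i) → ℝ, ∀ b h,
      U b h = 2 * ℓ b h ^ 2 + (2 * R) ^ 2 * pB b h := ⟨_, fun _ _ => rfl⟩
  have hrad0 : ∀ b h, 0 ≤ rad b h := fun b h => by
    rw [hrad]
    exact add_nonneg (mul_nonneg (mul_nonneg hC (pow_nonneg hθ _)) (pow_nonneg hκpos _)) (hℓ0 b h)
  have hradm : ∀ b, StronglyMeasurable (rad b) := fun b => by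
    rw [funext (hrad b)]
    exact ((measurable_const.mul (measurable_pow_card_filter (J b) (hG b) κ₁)).add
      (hℓm b).measurable).stronglyMeasurable
  have hIndm : ∀ b, StronglyMeasurable ((Bad b).indicator fun _ : Π k, X k => (1 : ℝ)) := fun b =>
    stronglyMeasurable_const.indicator (hBad b)
  have hIndb : ∀ b x, |(Bad b).indicator (fun _ : Π k, X k => (1 : ℝ)) x| ≤ 1 := fun b x => by
    by_cases hx : x ∈ Bad b <;> simp [hx]
  have hpBm : ∀ b, StronglyMeasurable (pB b) := fun b => by
    rw [funext (hpB b)]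
    exact stronglyMeasurable_fiberMean b (hIndm b)
  have hpB01 : ∀ b h, 0 ≤ pB b h ∧ pB b h ≤ 1 := fun b h => by
    rw [hpB]
    exact fiberMean_indicator_mem_Icc (κ := κ) b (hBad b) h
  have hcm : ∀ b, StronglyMeasurable (fun h => min (rad b h) (2 * R)) := fun b =>
    ((hradm b).measurable.min measurable_const).stronglyMeasurable
  have hWm : ∀ b, StronglyMeasurable (W b) := fun b => by
    rw [funext (hWdef b)]
    exact ((hcm b).pow 2).add (stronglyMeasurable_const.mul (hpBm b))
  have hUm : ∀ b, StronglyMeasurable (U b) := fun b => by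
    rw [funext (hUdef b)]
    exact (stronglyMeasurable_const.mul ((hℓm b).pow 2)).add (stronglyMeasurable_const.mul (hpBm b))
  have hR : ∀ b < n, ∀ h : (Π i : Iic b, X i), 0 ≤ R := fun b hb h => (abs_nonneg _).trans (hctrb b hb h)
  have hmin0 : ∀ b < n, ∀ h, 0 ≤ min (rad b h) (2 * R) := fun b hb h =>
    le_min (hrad0 b h) (by linarith [hR b hb h])
  have h4R2 : 0 ≤ (2 * R) ^ 2 := sq_nonneg _
  have hWb : ∀ b < n, ∀ h, |W b h| ≤ 2 * (2 * R) ^ 2 := by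
    intro b hb h
    rw [hWdef, abs_of_nonneg (add_nonneg (sq_nonneg _) (mul_nonneg h4R2 (hpB01 b h).1))]
    have h1 : (min (rad b h) (2 * R)) ^ 2 ≤ (2 * R) ^ 2 :=
      pow_le_pow_left₀ (hmin0 b hb h) (min_le_right _ _) 2
    have h2 : (2 * R) ^ 2 * pB b h ≤ (2 * R) ^ 2 := mul_le_of_le_one_right h4R2 (hpB01 b h).2
    linarith
  have hUb : ∀ b < n, ∀ h, |U b h| ≤ 2 * ℓmax ^ 2 + (2 * R) ^ 2 := by
    intro b hb h
    rw [hUdef, abs_of_nonneg (add_nonneg (mul_nonneg two_pos.le (sq_nonneg _)) (mul_nonneg h4R2 (hpB01 b h).1))]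
    exact add_le_add (mul_le_mul_of_nonneg_left (pow_le_pow_left₀ (hℓ0 b h) (hℓb b hb h) 2) two_pos.le)
      (mul_le_of_le_one_right h4R2 (hpB01 b h).2)
  -- first moments of the locality channel: `Σ_b ∫ U b = 2·Σ_b ∫ ℓ b² + (2R)²·Σ_b μ(Bad b)`
  have hUtot : ∑ b ∈ range n, ∫ x, U b (frestrictLe b x) ∂(Kernel.trajMeasure ν κ) ≤
      2 * Ltot + (2 * R) ^ 2 * Ptot := by
    have hUint : ∀ b < n, ∫ x, U b (frestrictLe b x) ∂(Kernel.trajMeasure ν κ) =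
        2 * ∫ x, ℓ b (frestrictLe b x) ^ 2 ∂(Kernel.trajMeasure ν κ) +
          (2 * R) ^ 2 * (Kernel.trajMeasure ν κ).real (Bad b) := by
      intro b hb
      have hℓ2m : StronglyMeasurable fun x : Π k, X k => ℓ b (frestrictLe b x) ^ 2 :=
        ((hℓm b).comp_measurable (measurable_frestrictLe b)).pow 2
      have hℓ2i : Integrable (fun x => ℓ b (frestrictLe b x) ^ 2) (Kernel.trajMeasure ν κ) :=
        integrable_of_abs_le_const hℓ2m (R := ℓmax ^ 2) fun x => by
          rw [abs_of_nonneg (sq_nonneg _)]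
          exact pow_le_pow_left₀ (hℓ0 b _) (hℓb b hb _) 2
      have hpBm' : StronglyMeasurable fun x : Π k, X k => pB b (frestrictLe b x) :=
        (hpBm b).comp_measurable (measurable_frestrictLe b)
      have hpBi : Integrable (fun x => pB b (frestrictLe b x)) (Kernel.trajMeasure ν κ) :=
        integrable_of_abs_le_const hpBm' (R := 1) fun x => by
          rw [abs_of_nonneg (hpB01 b _).1]
          exact (hpB01 b _).2
      have hpBint : ∫ x, pB b (frestrictLe b x) ∂(Kernel.trajMeasure ν κ) = (Kernel.trajMeasure ν κ).real (Bad b) := by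
        rw [integral_congr_ae (ae_of_all _ fun x => hpB b (frestrictLe b x))]
        change ∫ x, fiberMean κ b ((Bad b).indicator fun _ => (1 : ℝ)) (frestrictLe b x) ∂(Kernel.trajMeasure ν κ) = _
        rw [integral_fiberMean_comp_frestrictLe ν b (hIndm b) (hIndb b), integral_indicator (hBad b),
          setIntegral_const, smul_eq_mul, mul_one]
      rw [integral_congr_ae (ae_of_all _ fun x => hUdef b (frestrictLe b x))]
      change ∫ x, (2 * ℓ b (frestrictLe b x) ^ 2 + (2 * R) ^ 2 * pB b (frestrictLe b x)) ∂(Kernel.trajMeasure ν κ) = _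
      rw [integral_add (hℓ2i.const_mul 2) (hpBi.const_mul _), integral_const_mul, integral_const_mul, hpBint]
    rw [Finset.sum_congr rfl fun b hb => hUint b (mem_range.mp hb), sum_add_distrib, ← mul_sum, ← mul_sum]
    exact add_le_add (mul_le_mul_of_nonneg_left hL two_pos.le) (mul_le_mul_of_nonneg_left hP h4R2)
  -- (O″) ⇒ a.e. domination of the one-step variances by W (§2b)
  have hW : ∀ b < n, ∀ᵐ x ∂(Kernel.trajMeasure ν κ),
      oneStepVar κ b φ (frestrictLe b x) ≤ W b (frestrictLe b x) := by
    intro b hb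
    have hoscP' : ∀ᵐ x ∂(Kernel.trajMeasure ν κ), x ∉ Bad b →
        |φ x - ctr b (frestrictLe b x)| ≤ rad b (frestrictLe b x) := by
      filter_upwards [hoscP b hb] with x hx hxB
      rw [hrad]
      exact hx hxB
    have h := ae_oneStepVar_le_of_pathwise_osc (κ := κ) ν b hφm hφR (hctrm b) (hctrb b hb) (hradm b) (hrad0 b)
      (hBad b) hoscP'
    filter_upwards [h] with x hx
    rw [hWdef, hpB]
    exact hx
  -- W ≤ (√2·C)²(θ²)^{lvl}(κ₁²)^{N} + U pointwise
  have hWdom : ∀ b < n, ∀ h, W b h ≤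
      (Real.sqrt 2 * C) ^ 2 * (θ ^ 2) ^ lvl b * (κ₁ ^ 2) ^ ((J b).filter fun j => h ∈ G b j).card + U b h := by
    intro b hb h
    have h1 : (min (rad b h) (2 * R)) ^ 2 ≤ rad b h ^ 2 :=
      pow_le_pow_left₀ (hmin0 b hb h) (min_le_left _ _) 2
    have h2 : rad b h ^ 2 ≤ 2 * (C * θ ^ lvl b * κ₁ ^ ((J b).filter fun j => h ∈ G b j).card) ^ 2 +
        2 * ℓ b h ^ 2 := by
      rw [hrad]
      nlinarith [sq_nonneg (C * θ ^ lvl b * κ₁ ^ ((J b).filter fun j => h ∈ G b j).card - ℓ b h)]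
    have h3 : 2 * (C * θ ^ lvl b * κ₁ ^ ((J b).filter fun j => h ∈ G b j).card) ^ 2 =
        (Real.sqrt 2 * C) ^ 2 * (θ ^ 2) ^ lvl b * (κ₁ ^ 2) ^ ((J b).filter fun j => h ∈ G b j).card := by
      rw [mul_pow (Real.sqrt 2), Real.sq_sqrt (by norm_num : (0 : ℝ) ≤ 2), ← pow_mul, ← pow_mul,
        mul_comm 2 (lvl b), mul_comm 2 ((J b).filter fun j => h ∈ G b j).card, pow_mul, pow_mul]
      ring
    rw [hWdef, hUdef]
    linarith [h1, h2, h3.le, h3.ge]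
  have hκ₀ : 1 ≤ κ₁ ^ 2 := one_le_pow₀ hκ₁
  have hmain := integral_mul_exp_le_uniform_of_nesting_chain (κ := κ) ν n hφn hφR hWm hWb hW lvl hN₀ hΛ hr
    hlvl hcard J G (fun b _ => hG b) hε hE hκ₀ hdom (Real.sqrt 2 * C) hUm hUb hUtot hWdom ht hB hg hg0 hCg hgC
  rw [mul_pow (Real.sqrt 2), Real.sq_sqrt (by norm_num : (0 : ℝ) ≤ 2)] at hmain
  exact hmain

end PathwiseEndToEnd

/-! ## §4  The same three bounds under a GIVEN path law (standard Borel carriers): `κ := posteriorKernel μ` -/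

section PathLaw

variable {X : ℕ → Type*} [∀ n, MeasurableSpace (X n)] [∀ n, StandardBorelSpace (X n)] [∀ n, Nonempty (X n)]
variable {ι : Type*}

open scoped Classical in
/-- [folklore] **VARIANCE-PROXY FORM UNDER A GIVEN PATH LAW.**  `integral_mul_exp_le_uniform_of_nesting_chain` for an
arbitrary finite path law `μ` on `Π n, X n` (standard Borel nonempty carriers), presented backward as the realised
chain of its own posterior kernels (`T4CouplingChain.trajMeasure_posteriorKernel_eq`): every conditional object is
`posteriorKernel μ`'s, every integral is against `μ`, and the endpoint integral is against the unit-lattice marginal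
`μ.map (· 0)`. -/
theorem integral_mul_exp_le_uniform_of_nesting_pathLaw (μ : Measure (Π n, X n)) [IsFiniteMeasure μ] (n : ℕ)
    {φ : (Π k, X k) → ℝ} (hφn : StronglyMeasurable[piLE (X := X) n] φ) {R : ℝ} (hφR : ∀ x, |φ x| ≤ R)
    {W : (b : ℕ) → (Π i : Iic b, X i) → ℝ} (hWm : ∀ b, StronglyMeasurable (W b)) {Vmax : ℝ}
    (hWb : ∀ b < n, ∀ h, |W b h| ≤ Vmax)
    (hW : ∀ b < n, ∀ᵐ x ∂μ, oneStepVar (posteriorKernel μ) b φ (frestrictLe b x) ≤ W b (frestrictLe b x))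
    (lvl : ℕ → ℕ) {N₀ Λ θ : ℝ} {K : ℕ} (hN₀ : 0 ≤ N₀) (hΛ : 0 ≤ Λ) (hr : Λ * θ ^ 2 < 1)
    (hlvl : ∀ b < n, lvl b < K)
    (hcard : ∀ m < K, (((range n).filter fun b => lvl b = m).card : ℝ) ≤ N₀ * Λ ^ m)
    (J : ℕ → Finset ι) (G : (b : ℕ) → ι → Set (Π i : Iic b, X i))
    (hG : ∀ b < n, ∀ j ∈ J b, MeasurableSet (G b j))
    {ε : ℕ → ι → ℝ} (hε : ∀ b < n, ∀ j ∈ J b, 0 ≤ ε b j) {E : ℝ} (hE : ∀ b < n, ∑ j ∈ J b, ε b j ≤ E)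
    {κ₀ : ℝ} (hκ₀ : 1 ≤ κ₀)
    (hdom : ∀ b < n, ∀ S ⊆ J b,
      μ.real (⋂ j ∈ S, frestrictLe b ⁻¹' G b j) ≤ μ.real Set.univ * ∏ j ∈ S, ε b j)
    (C : ℝ) {U : (b : ℕ) → (Π i : Iic b, X i) → ℝ} (hUm : ∀ b, StronglyMeasurable (U b)) {Umax : ℝ}
    (hUb : ∀ b < n, ∀ h, |U b h| ≤ Umax) {Utot : ℝ}
    (hU : ∑ b ∈ range n, ∫ x, U b (frestrictLe b x) ∂μ ≤ Utot)
    (hWdom : ∀ b < n, ∀ h, W b h ≤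
      C ^ 2 * (θ ^ 2) ^ lvl b * κ₀ ^ ((J b).filter fun j => h ∈ G b j).card + U b h)
    {t : ℝ} (ht : |t| * (2 * R) ≤ 1) {B : ℝ} (hB : 0 < B) {g₀ : X 0 → ℝ} (hg : StronglyMeasurable g₀)
    (hg0 : ∀ z, 0 ≤ g₀ z) {Cg : ℝ} (hCg : 0 ≤ Cg) (hgC : ∀ z, g₀ z ≤ Cg) :
    ∫ x, g₀ (x 0) * Real.exp (t * φ x) ∂μ ≤
      Real.exp (t ^ 2 * B) * ∫ z, g₀ z * Real.exp (t * towerMean (posteriorKernel μ) φ z) ∂(μ.map fun x => x 0) +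
        Real.exp (|t| * R) *
          (Cg * (B⁻¹ * (N₀ * (C ^ 2 * (μ.real Set.univ * Real.exp ((κ₀ - 1) * E))) *
            geomPolyConst 0 (Λ * θ ^ 2) + Utot))) := by
  have h := integral_mul_exp_le_uniform_of_nesting_chain (κ := posteriorKernel μ) (μ.map fun x => x 0) n hφn hφR
    hWm hWb (by rw [trajMeasure_posteriorKernel_eq μ]; exact hW) lvl hN₀ hΛ hr hlvl hcard J G hG hε hE hκ₀
    (by rw [trajMeasure_posteriorKernel_eq μ]; exact hdom) C hUm hUb (Utot := Utot)
    (by rw [trajMeasure_posteriorKernel_eq μ]; exact hU) hWdom ht hB hg hg0 hCg hgC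
  rw [trajMeasure_posteriorKernel_eq μ] at h
  exact h

open scoped Classical in
/-- [folklore] **OSCILLATION FORM UNDER A GIVEN PATH LAW** — the per-step kernel form of NE1′'s remaining inputs for the
UNDRESSED path law `μ` of the printed chain presented backward: (O) a.e. oscillation of consecutive conditional means
`fiberMean (posteriorKernel μ) (b+1) φ (x≤(b+1))` about predictable centres within the nesting-regularity radius
inflated per revealed creation event plus a locality radius, (J) product domination of the revealed creation events
under `μ`, (L) summable locality first moments ⇒ the endpoint-conditioned exponential-moment bound, uniformly in the
depth.  See `integral_mul_exp_le_uniform_of_oscillation`. -/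
theorem integral_mul_exp_le_uniform_of_oscillation_pathLaw (μ : Measure (Π n, X n)) [IsFiniteMeasure μ] (n : ℕ)
    {φ : (Π k, X k) → ℝ} (hφn : StronglyMeasurable[piLE (X := X) n] φ) {R : ℝ} (hφR : ∀ x, |φ x| ≤ R)
    (lvl : ℕ → ℕ) {N₀ Λ θ : ℝ} {K : ℕ} (hN₀ : 0 ≤ N₀) (hΛ : 0 ≤ Λ) (hθ : 0 ≤ θ) (hr : Λ * θ ^ 2 < 1)
    (hlvl : ∀ b < n, lvl b < K)
    (hcard : ∀ m < K, (((range n).filter fun b => lvl b = m).card : ℝ) ≤ N₀ * Λ ^ m)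
    (J : ℕ → Finset ι) (G : (b : ℕ) → ι → Set (Π i : Iic b, X i))
    (hG : ∀ b, ∀ j ∈ J b, MeasurableSet (G b j))
    {ε : ℕ → ι → ℝ} (hε : ∀ b < n, ∀ j ∈ J b, 0 ≤ ε b j) {E : ℝ} (hE : ∀ b < n, ∑ j ∈ J b, ε b j ≤ E)
    {κ₁ : ℝ} (hκ₁ : 1 ≤ κ₁)
    (hdom : ∀ b < n, ∀ S ⊆ J b,
      μ.real (⋂ j ∈ S, frestrictLe b ⁻¹' G b j) ≤ μ.real Set.univ * ∏ j ∈ S, ε b j)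
    {C : ℝ} (hC : 0 ≤ C)
    {ctr : (b : ℕ) → (Π i : Iic b, X i) → ℝ} (hctrm : ∀ b, StronglyMeasurable (ctr b))
    (hctrb : ∀ b < n, ∀ h, |ctr b h| ≤ R)
    {ℓ : (b : ℕ) → (Π i : Iic b, X i) → ℝ} (hℓm : ∀ b, StronglyMeasurable (ℓ b)) (hℓ0 : ∀ b h, 0 ≤ ℓ b h)
    {ℓmax : ℝ} (hℓb : ∀ b < n, ∀ h, ℓ b h ≤ ℓmax) {Ltot : ℝ}
    (hL : ∑ b ∈ range n, ∫ x, ℓ b (frestrictLe b x) ^ 2 ∂μ ≤ Ltot)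
    (hosc : ∀ b < n, ∀ᵐ x ∂μ,
      |fiberMean (posteriorKernel μ) (b + 1) φ (frestrictLe (b + 1) x) - ctr b (frestrictLe b x)| ≤
        C * θ ^ lvl b * κ₁ ^ ((J b).filter fun j => frestrictLe b x ∈ G b j).card + ℓ b (frestrictLe b x))
    {t : ℝ} (ht : |t| * (2 * R) ≤ 1) {B : ℝ} (hB : 0 < B) {g₀ : X 0 → ℝ} (hg : StronglyMeasurable g₀)
    (hg0 : ∀ z, 0 ≤ g₀ z) {Cg : ℝ} (hCg : 0 ≤ Cg) (hgC : ∀ z, g₀ z ≤ Cg) :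
    ∫ x, g₀ (x 0) * Real.exp (t * φ x) ∂μ ≤
      Real.exp (t ^ 2 * B) * ∫ z, g₀ z * Real.exp (t * towerMean (posteriorKernel μ) φ z) ∂(μ.map fun x => x 0) +
        Real.exp (|t| * R) *
          (Cg * (B⁻¹ * (N₀ * (2 * C ^ 2 * (μ.real Set.univ * Real.exp ((κ₁ ^ 2 - 1) * E))) *
            geomPolyConst 0 (Λ * θ ^ 2) + 2 * Ltot))) := by
  have h := integral_mul_exp_le_uniform_of_oscillation (κ := posteriorKernel μ) (μ.map fun x => x 0) n hφn hφR
    lvl hN₀ hΛ hθ hr hlvl hcard J G hG hε hE hκ₁ (by rw [trajMeasure_posteriorKernel_eq μ]; exact hdom) hC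
    hctrm hctrb hℓm hℓ0 hℓb (Ltot := Ltot) (by rw [trajMeasure_posteriorKernel_eq μ]; exact hL)
    (by rw [trajMeasure_posteriorKernel_eq μ]; exact hosc) ht hB hg hg0 hCg hgC
  rw [trajMeasure_posteriorKernel_eq μ] at h
  exact h

open scoped Classical in
/-- [folklore] **PATHWISE-OSCILLATION FORM UNDER A GIVEN PATH LAW** — the per-step kernel form of NE1′'s remaining inputs
for the UNDRESSED path law `μ` of the printed chain presented backward, with (O) replaced by the pathwise statement
(O″) about the loop observable itself off bad events of summable probability (P); every conditional object is
`posteriorKernel μ`'s.  See `integral_mul_exp_le_uniform_of_pathwiseOsc`. -/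
theorem integral_mul_exp_le_uniform_of_pathwiseOsc_pathLaw (μ : Measure (Π n, X n)) [IsFiniteMeasure μ] (n : ℕ)
    {φ : (Π k, X k) → ℝ} (hφn : StronglyMeasurable[piLE (X := X) n] φ) {R : ℝ} (hφR : ∀ x, |φ x| ≤ R)
    (lvl : ℕ → ℕ) {N₀ Λ θ : ℝ} {K : ℕ} (hN₀ : 0 ≤ N₀) (hΛ : 0 ≤ Λ) (hθ : 0 ≤ θ) (hr : Λ * θ ^ 2 < 1)
    (hlvl : ∀ b < n, lvl b < K)
    (hcard : ∀ m < K, (((range n).filter fun b => lvl b = m).card : ℝ) ≤ N₀ * Λ ^ m)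
    (J : ℕ → Finset ι) (G : (b : ℕ) → ι → Set (Π i : Iic b, X i))
    (hG : ∀ b, ∀ j ∈ J b, MeasurableSet (G b j))
    {ε : ℕ → ι → ℝ} (hε : ∀ b < n, ∀ j ∈ J b, 0 ≤ ε b j) {E : ℝ} (hE : ∀ b < n, ∑ j ∈ J b, ε b j ≤ E)
    {κ₁ : ℝ} (hκ₁ : 1 ≤ κ₁)
    (hdom : ∀ b < n, ∀ S ⊆ J b,
      μ.real (⋂ j ∈ S, frestrictLe b ⁻¹' G b j) ≤ μ.real Set.univ * ∏ j ∈ S, ε b j)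
    {C : ℝ} (hC : 0 ≤ C)
    {ctr : (b : ℕ) → (Π i : Iic b, X i) → ℝ} (hctrm : ∀ b, StronglyMeasurable (ctr b))
    (hctrb : ∀ b < n, ∀ h, |ctr b h| ≤ R)
    {ℓ : (b : ℕ) → (Π i : Iic b, X i) → ℝ} (hℓm : ∀ b, StronglyMeasurable (ℓ b)) (hℓ0 : ∀ b h, 0 ≤ ℓ b h)
    {ℓmax : ℝ} (hℓb : ∀ b < n, ∀ h, ℓ b h ≤ ℓmax) {Ltot : ℝ}
    (hL : ∑ b ∈ range n, ∫ x, ℓ b (frestrictLe b x) ^ 2 ∂μ ≤ Ltot)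
    (Bad : ℕ → Set (Π k, X k)) (hBad : ∀ b, MeasurableSet (Bad b)) {Ptot : ℝ}
    (hP : ∑ b ∈ range n, μ.real (Bad b) ≤ Ptot)
    (hoscP : ∀ b < n, ∀ᵐ x ∂μ, x ∉ Bad b →
      |φ x - ctr b (frestrictLe b x)| ≤
        C * θ ^ lvl b * κ₁ ^ ((J b).filter fun j => frestrictLe b x ∈ G b j).card + ℓ b (frestrictLe b x))
    {t : ℝ} (ht : |t| * (2 * R) ≤ 1) {B : ℝ} (hB : 0 < B) {g₀ : X 0 → ℝ} (hg : StronglyMeasurable g₀)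
    (hg0 : ∀ z, 0 ≤ g₀ z) {Cg : ℝ} (hCg : 0 ≤ Cg) (hgC : ∀ z, g₀ z ≤ Cg) :
    ∫ x, g₀ (x 0) * Real.exp (t * φ x) ∂μ ≤
      Real.exp (t ^ 2 * B) * ∫ z, g₀ z * Real.exp (t * towerMean (posteriorKernel μ) φ z) ∂(μ.map fun x => x 0) +
        Real.exp (|t| * R) *
          (Cg * (B⁻¹ * (N₀ * (2 * C ^ 2 * (μ.real Set.univ * Real.exp ((κ₁ ^ 2 - 1) * E))) *
            geomPolyConst 0 (Λ * θ ^ 2) + (2 * Ltot + (2 * R) ^ 2 * Ptot)))) := by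
  have h := integral_mul_exp_le_uniform_of_pathwiseOsc (κ := posteriorKernel μ) (μ.map fun x => x 0) n hφn hφR
    lvl hN₀ hΛ hθ hr hlvl hcard J G hG hε hE hκ₁ (by rw [trajMeasure_posteriorKernel_eq μ]; exact hdom) hC
    hctrm hctrb hℓm hℓ0 hℓb (Ltot := Ltot) (by rw [trajMeasure_posteriorKernel_eq μ]; exact hL) Bad hBad
    (Ptot := Ptot) (by rw [trajMeasure_posteriorKernel_eq μ]; exact hP)
    (by rw [trajMeasure_posteriorKernel_eq μ]; exact hoscP) ht hB hg hg0 hCg hgC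
  rw [trajMeasure_posteriorKernel_eq μ] at h
  exact h

end PathLaw

end Literature.MathematicalPhysics.QuantumFieldTheory.Balaban1983to89.T4CouplingDomination

end
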